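import Mathlib
import Literature.Combinatorics.Optimization.JuntaApproximation
import HarnessLib

/-!
# Nonnegative rank versus junta degree (Lee–Raghavendra–Steurer 2015, §7.1) — Lemma 7.1 and Theorem 7.2 (lower bound) PROVED

Lee–Raghavendra–Steurer's §7 ("Nonnegative rank") is the LP-side companion of their psd-rank theory:
"thm:gtwo-pseudodist exhibits a connection between psd rank and sos degree. There is a similar
connection between nonnegative rank and junta-degree. The results of sec:nnr-vs-junta generalize those
of [ChanLRS13], while the method of proof is closely related. As opposed to [ChanLRS13], we use the
learning approach of sec:learning to approximate by juntas." (p. 27).  This file types the §7.1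
vocabulary — for an ARBITRARY finite alphabet `X` and an arbitrary measure, as printed — and PROVES the
duality **Lemma 7.1**; the companion `JuntaApproximation.lean` holds the learning tool (Thm 4.8).

Printed statements (p. 27, verbatim up to notation):

* "Fix a finite set `X`. For a nonnegative function `f : Xⁿ → ℝ₊`, we say that `f` has a nonnegative
  junta certificate of degree `d` if there exist nonnegative `d`-juntas `g_1, g_2, …, g_k : Xⁿ → ℝ₊`
  such that `f = Σ_{i=1}^k g_i` (as functions on the discrete cube). The junta degree of `f`, denoted
  `juntadeg(f)`, is the minimal `d` such that `f` has a nonnegative junta certificate of degree `d`."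
  — `HasJuntaCertificate d f`, `juntaDegree f` (an infimum over `ℕ`; for `X = {0,1}` these are the
  tree's Kothari–Meka–Raghavendra notions `IsConicalJunta` / `nonnegDegree`:
  `hasJuntaCertificate_iff_isConicalJunta`, `juntaDegree_eq_nonnegDegree`).
* "Consider an arbitrary measure `μ` on `Xⁿ`. A function `D : Xⁿ → ℝ` is called a `d`-local
  pseudo-density (with respect to the measure `μ`) if `E_μ D = 1` and furthermore
  `E_{x∼μ} D(x) g(x) ≥ 0` for all nonnegative `d`-juntas `g`. If a measure `μ` is unspecified, we
  always refer to the uniform measure by default." — `IsLocalPseudoDensity μ d D` (`μ` a weight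
  `Xⁿ → ℝ`, `E_μ` = `muExpect μ` of `JuntaApproximation.lean`).
* **Lemma 7.1.** "For every `f : Xⁿ → ℝ₊` and `d ≥ 0`, we have `juntadeg(f) > d` if and only if there
  exists a `d`-local pseudo-density such that `E_x D(x) f(x) < 0`."  ("The following characterization
  is immediate from the fact that the set of functions satisfying `juntadeg(f) ≤ d` is a closed convex
  cone.") — `LeeRaghavendraSteurer2015_lemma71` (uniform measure, as printed) and the form for any
  measure of FULL support `LeeRaghavendraSteurer2015_lemma71_of_pos` (the "if" direction for any
  nonnegative measure: `not_hasJuntaCertificate_of_pseudoDensity`).  PROVED: the cone of functions with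
  a degree-`d` certificate is the cone generated by the finitely many cylinder indicators
  `𝟙[x|_S = p]` (`|S| ≤ d`, `p : S → X`; `cylinderFn`, `IsSJunta.eq_sum_cylinderFn`), so Farkas' lemma
  in the tree's form `Literature.Analysis.Convex.LPDuality.farkas_nonneg_eq` [Schrijver1986, Cor. 7.1d]
  separates; the separating vector `y` is turned into the pseudo-density `y/μ`, normalised (if
  `⟨y, 1⟩ = 0` one uses `1 + t·y/μ` for large `t`).

Rendering decisions: `Xⁿ` is `ι → X` for a finite index type `ι`; "measure on `Xⁿ`" = weight
`μ : (ι → X) → ℝ` (for the duality, `μ > 0` pointwise — for the uniform measure of the printed default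
this holds; with `μ`-null points the "only if" direction fails, the certificate being a pointwise
identity); `juntadeg` of a function with no certificate of any degree (impossible for `f ≥ 0`,
`hasJuntaCertificate_card`) is `0` by the `sInf` convention, so the `juntaDegree` form of Lemma 7.1
carries `f ≥ 0` as printed.

Second part (appended): **the bookkeeping of the proof of Theorem 7.2** (p. 27–28), PROVED —
product measures `μⁿ` on `Xⁿ` (`piWeight`/`prodWeight`, `isProbWeight_piWeight`), the pattern matrix
`M_n^f(S,x) = f(x_S)` over a general alphabet (`generalPatternMatrix`; `= patternMatrix` over `{0,1}`),
the disintegration along `x_S` used in the display "`E_{x∼μⁿ} D_S(x) q̃_i(x) = E_{y∼μ^m} D_S(y)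
E_{x∼μⁿ}[q̃_i(x) | x_S = y]`" (`condAvg`, `muExpect_restrictFin_mul`; row means
`E_{μⁿ} M_n^f(S,·) = E_{μ^m} f`, eq. (7.5): `muExpect_generalPatternMatrix`), the junta transport
"`y ↦ E[q̃_i(x) | x_S = y]` is a nonnegative `(S ∩ J_i)`-junta" (`isSJunta_condAvg`,
`card_pullbackSet_le`), and the planting count behind "`Pr(|S ∩ J_i| > d) ≤ …`"
(`sum_choose_card_inter`: `Σ_{|S|=m} C(|S∩J|,k) = C(|J|,k)·C(n−k,m−k)`; `card_filter_inter_gt_le`;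
`choose_sub_div_choose`, `choose_div_choose_le_pow`: `C(n−k,m−k)/C(n,m) = C(m,k)/C(n,k) ≤ (m/n)^k`).

Third part (appended): **Theorem 7.2, the lower bound, PROVED in the form the printed proof
delivers.**  Printed (p. 27): "For any finite set `X`, any measure `μ` on `X`, and any `ε > 0`, the
following holds. For any `f : X^m → ℝ₊` and all `n ≥ 2m`,
`1 + n^{d+1} ≥ nnr(M_n^f) ≥ (c ε² n / (m² (d log n + log(‖f‖_∞/‖f‖₁))))^d`, where
`d + 1 = juntadeg^ε(f; μ^m)` and `c > 0` is a universal constant", with (eq. (7.1))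
`juntadeg^ε(f; μ) = 1 + max{d : ∃ a d-local pseudo-density D w.r.t. μ and E_μ D f < −ε‖D‖_∞ E_μ f}`
(`approxJuntaDegree`; `‖f‖₁ = E_{μ^m} f`).  What is proved here, following the printed proof step by
step (normalised columns `q_i`, eq. (7.4)–(7.5); the split `Λ_τ = {i : ‖q_i‖_∞ ≤ τ}`, eq. (7.6); junta
approximation of the bounded columns against the tests `D_S` by Thm 4.8, eq. (7.7); testing the
factorisation against `E_S D_S`, eq. (7.8)–(7.9); `d`-locality and the planting estimate):
`LeeRaghavendraSteurer2015_thm72_lower` — if `D` is `d`-local w.r.t. `μ^m` with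
`E[D f] < −ε‖D‖_∞‖f‖₁` and `nnr(M_n^f) ≤ r`, then `r > (ε/3)·(ε² n/(48 m² log τ))^{d+1}`,
`τ = 3r‖f‖_∞/(ε‖f‖₁)`; the two-regime corollary `LeeRaghavendraSteurer2015_thm72_lower'`
(`r ≥ n^{d+1}` or `r > (ε/3)(ε² n/(48 m²((d+1) log n + log(‖f‖_∞/‖f‖₁) + log(3/ε))))^{d+1}`) and the
form with the printed hypothesis `d + 1 ≤ juntadeg^ε` (`…_of_approxJuntaDegree`).

RECORDED DEVIATIONS FROM THE PRINTED SENTENCE (print-vs-proof, not a change of content of the proof):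
(i) the printed choice "`τ = 3r‖f‖_∞/‖f‖₁`" (p. 28) makes the discarded-columns term
`r‖D‖_∞‖f‖_∞/τ = ‖D‖_∞‖f‖₁/3`, which is NOT `≤ (ε/3)‖D‖_∞‖f‖₁`; the proof needs
`τ = 3r‖f‖_∞/(ε‖f‖₁)`, whence the prefactor `ε/3` and the extra `log(3/ε)` inside `log τ` above — the
literal `(cε²n/(m²(d log n + log(‖f‖_∞/‖f‖₁))))^d` with `c` universal is not what the argument yields
for small `ε` (for `ε` bounded below, e.g. the constant `ε₀` of Lemma 7.3, the shapes agree up to the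
value of `c`); the exponent `d + 1` is what the planting estimate `Pr(|S ∩ J| > d) ≤ (|J| m/n)^{d+1}`
gives (the print has `d`).  (ii) The printed UPPER bound "`1 + n^{d+1} ≥ nnr(M_n^f)`" with
`d + 1 = juntadeg^ε` is not justified by the sentence offered ("the cone of nonnegative `d`-juntas is
spanned by `Σ_{i ≤ d+1} C(n,i) ≤ 1 + n^{d+1}` nonnegative `d`-juntas"): `juntadeg^ε ≤ juntadeg` (a
witness for `juntadeg^ε > d` is a witness for `juntadeg > d`, Lemma 7.1), so a junta certificate of
degree `juntadeg^ε(f)` need not exist, and over a general alphabet the generator count carries a factor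
`|X|^i`; the upper bound is therefore not typed here.

0 named facts, no `sorry`.  §7.2 (Lemma 7.3, Thm 7.4, Cor. 7.5) is not (yet) in this file.  Source:
J. R. Lee, P. Raghavendra, D. Steurer, STOC 2015 [LeeRaghavendraSteurer2015]; held text
`paper:arxiv-1411.6317` (arXiv rendering), §7.1 p. 27–28.
-/

noncomputable section

open Finset Matrix

namespace Literature.Combinatorics.Optimization

/-! ### Junta certificates and junta degree -/

section Certificates

variable {ι X : Type*}

/-- `f : X^ι → ℝ` **has a nonnegative junta certificate of degree `d`**: `f = Σ_{i=1}^k g_i` with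
nonnegative `d`-juntas `g_i`. [cite: LeeRaghavendraSteurer2015, §7.1 (p. 27)] -/
def HasJuntaCertificate (d : ℕ) (f : (ι → X) → ℝ) : Prop :=
  ∃ (k : ℕ) (g : Fin k → (ι → X) → ℝ),
    (∀ i, IsKJunta d (g i)) ∧ (∀ i x, 0 ≤ g i x) ∧ ∀ x, f x = ∑ i, g i x

/-- **The junta degree `juntadeg(f)`**: the minimal `d` such that `f` has a nonnegative junta
certificate of degree `d` (infimum over `ℕ`). [cite: LeeRaghavendraSteurer2015, §7.1 (p. 27)] -/
def juntaDegree (f : (ι → X) → ℝ) : ℕ := sInf {d | HasJuntaCertificate d f}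

/-- Certificates persist when the degree bound is raised. [cite: LeeRaghavendraSteurer2015, §7.1 (p. 27)] -/
theorem HasJuntaCertificate.mono {d d' : ℕ} {f : (ι → X) → ℝ} (hdd' : d ≤ d')
    (h : HasJuntaCertificate d f) : HasJuntaCertificate d' f := by
  obtain ⟨k, g, hg, hg0, hf⟩ := h
  exact ⟨k, g, fun i => (hg i).mono hdd', hg0, hf⟩

/-- A function with a certificate is nonnegative. [cite: LeeRaghavendraSteurer2015, §7.1 (p. 27)] -/
theorem HasJuntaCertificate.nonneg {d : ℕ} {f : (ι → X) → ℝ} (h : HasJuntaCertificate d f)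
    (x : ι → X) : 0 ≤ f x := by
  obtain ⟨k, g, -, hg0, hf⟩ := h
  rw [hf x]
  exact sum_nonneg fun i _ => hg0 i x

/-- A sum of two certified functions is certified. [cite: LeeRaghavendraSteurer2015, §7.1 (p. 27: "closed convex cone")] -/
theorem HasJuntaCertificate.add {d : ℕ} {f f' : (ι → X) → ℝ} (h : HasJuntaCertificate d f)
    (h' : HasJuntaCertificate d f') : HasJuntaCertificate d (fun x => f x + f' x) := by
  obtain ⟨k, g, hg, hg0, hf⟩ := h
  obtain ⟨k', g', hg', hg0', hf'⟩ := h'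
  refine ⟨k + k', Fin.append g g', fun i => ?_, fun i x => ?_, fun x => ?_⟩
  · refine Fin.addCases (fun i => ?_) (fun i => ?_) i
    · simpa using hg i
    · simpa using hg' i
  · refine Fin.addCases (fun i => ?_) (fun i => ?_) i
    · simpa using hg0 i x
    · simpa using hg0' i x
  · rw [Fin.sum_univ_add]
    simp [hf x, hf' x]

/-- A nonnegative multiple of a certified function is certified. [cite: LeeRaghavendraSteurer2015, §7.1 (p. 27: "closed convex cone")] -/
theorem HasJuntaCertificate.const_mul {d : ℕ} {f : (ι → X) → ℝ} (h : HasJuntaCertificate d f)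
    {c : ℝ} (hc : 0 ≤ c) : HasJuntaCertificate d (fun x => c * f x) := by
  obtain ⟨k, g, hg, hg0, hf⟩ := h
  refine ⟨k, fun i x => c * g i x, fun i => (hg i).comp (fun t => c * t), fun i x =>
    mul_nonneg hc (hg0 i x), fun x => ?_⟩
  show c * f x = ∑ i, c * g i x
  rw [hf x, mul_sum]

/-- A single nonnegative `d`-junta is certified. [cite: LeeRaghavendraSteurer2015, §7.1 (p. 27)] -/
theorem hasJuntaCertificate_of_isKJunta {d : ℕ} {g : (ι → X) → ℝ} (hg : IsKJunta d g)
    (hg0 : ∀ x, 0 ≤ g x) : HasJuntaCertificate d g :=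
  ⟨1, fun _ => g, fun _ => hg, fun _ => hg0, fun x => by simp⟩

/-- A finite sum of nonnegative `d`-juntas (indexed by any finite type) is certified.
[cite: LeeRaghavendraSteurer2015, §7.1 (p. 27)] -/
theorem hasJuntaCertificate_sum {κ : Type*} [Fintype κ] {d : ℕ} (g : κ → (ι → X) → ℝ)
    (hg : ∀ j, IsKJunta d (g j)) (hg0 : ∀ j x, 0 ≤ g j x) :
    HasJuntaCertificate d (fun x => ∑ j, g j x) := by
  classical
  refine ⟨Fintype.card κ, fun i => g ((Fintype.equivFin κ).symm i), fun i => hg _, fun i x => hg0 _ x,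
    fun x => ?_⟩
  exact (Equiv.sum_comp (Fintype.equivFin κ).symm (fun j => g j x)).symm

/-- Every `f ≥ 0` on a finite cube has a certificate of degree `|ι|` (it is itself an `|ι|`-junta).
[cite: LeeRaghavendraSteurer2015, §7.1 (p. 27)] -/
theorem hasJuntaCertificate_card [Fintype ι] {f : (ι → X) → ℝ} (hf : ∀ x, 0 ≤ f x) :
    HasJuntaCertificate (Fintype.card ι) f := by
  refine hasJuntaCertificate_of_isKJunta ⟨univ, by simp, fun x y hxy => ?_⟩ hf
  rw [show x = y from funext fun i => hxy i (mem_univ i)]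

/-- `juntadeg(f)` is attained for `f ≥ 0`. [cite: LeeRaghavendraSteurer2015, §7.1 (p. 27)] -/
theorem hasJuntaCertificate_juntaDegree [Fintype ι] {f : (ι → X) → ℝ} (hf : ∀ x, 0 ≤ f x) :
    HasJuntaCertificate (juntaDegree f) f :=
  Nat.sInf_mem (s := {d | HasJuntaCertificate d f}) ⟨_, hasJuntaCertificate_card hf⟩

/-- `juntadeg(f) > d` iff `f` has no certificate of degree `d` (for `f ≥ 0`).
[cite: LeeRaghavendraSteurer2015, §7.1 (p. 27)] -/
theorem lt_juntaDegree_iff [Fintype ι] {f : (ι → X) → ℝ} (hf : ∀ x, 0 ≤ f x) {d : ℕ} :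
    d < juntaDegree f ↔ ¬ HasJuntaCertificate d f := by
  constructor
  · intro h
    exact Nat.notMem_of_lt_sInf (s := {d | HasJuntaCertificate d f}) h
  · intro h
    by_contra hle
    exact h ((hasJuntaCertificate_juntaDegree hf).mono (not_lt.mp hle))

/-- `juntadeg(f) ≤ d` iff `f` has a certificate of degree `d` (for `f ≥ 0`).
[cite: LeeRaghavendraSteurer2015, §7.1 (p. 27)] -/
theorem juntaDegree_le_iff [Fintype ι] {f : (ι → X) → ℝ} (hf : ∀ x, 0 ≤ f x) {d : ℕ} :
    juntaDegree f ≤ d ↔ HasJuntaCertificate d f := by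
  have := lt_juntaDegree_iff hf (d := d)
  constructor
  · intro h; by_contra hc; exact absurd (this.mpr hc) (not_lt.mpr h)
  · intro h; by_contra hc; exact this.mp (not_le.mp hc) h

/-- For the Boolean cube the junta certificates are exactly Kothari–Meka–Raghavendra's conical juntas.
[cite: KothariMekaRaghavendra2017, Def. 1.8 (p. 4)] -/
theorem hasJuntaCertificate_iff_isConicalJunta {n d : ℕ} (f : (Fin n → Bool) → ℝ) :
    HasJuntaCertificate d f ↔ IsConicalJunta d f := by
  constructor
  · rintro ⟨k, g, hg, hg0, hf⟩
    exact ⟨k, fun _ => 1, g, fun _ => zero_le_one, fun i => (isKJunta_iff_isJunta _).mp (hg i), hg0,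
      fun x => by simpa using hf x⟩
  · rintro ⟨t, lam, h, hlam, hh, hh0, hf⟩
    refine ⟨t, fun i x => lam i * h i x, fun i => ?_, fun i x => mul_nonneg (hlam i) (hh0 i x), hf⟩
    exact ((isKJunta_iff_isJunta _).mpr (hh i)).comp (fun s => lam i * s)

/-- Hence `juntadeg = deg_+` on the Boolean cube. [cite: KothariMekaRaghavendra2017, Def. 1.9 (p. 4)] -/
theorem juntaDegree_eq_nonnegDegree {n : ℕ} (f : (Fin n → Bool) → ℝ) :
    juntaDegree f = nonnegDegree f := by
  unfold juntaDegree nonnegDegree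
  congr 1
  ext d
  exact hasJuntaCertificate_iff_isConicalJunta f

end Certificates

/-! ### Cylinder indicators: the finite generating set of the certificate cone -/

section Cylinders

variable {ι X : Type*} [DecidableEq X]

/-- The cylinder indicator `𝟙[x|_S = p]` of a pattern `p : S → X`. [cite: LeeRaghavendraSteurer2015, §7.2 (p. 28: "any nonnegative S-junta is a nonnegative combination of the functions 𝟙_b as b ranges over {0,1}^S")] -/
def cylinderFn (S : Finset ι) (p : S → X) : (ι → X) → ℝ :=
  fun x => if (∀ i : S, x i = p i) then 1 else 0

/-- Cylinders are nonnegative. [cite: LeeRaghavendraSteurer2015, §7.2 (p. 28)] -/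
theorem cylinderFn_nonneg (S : Finset ι) (p : S → X) (x : ι → X) : 0 ≤ cylinderFn S p x := by
  unfold cylinderFn; split_ifs <;> norm_num

/-- A cylinder over `S` is an `S`-junta. [cite: LeeRaghavendraSteurer2015, §7.2 (p. 28)] -/
theorem isSJunta_cylinderFn (S : Finset ι) (p : S → X) : IsSJunta S (cylinderFn S p) := by
  intro x y hxy
  unfold cylinderFn
  have : (∀ i : S, x i = p i) ↔ (∀ i : S, y i = p i) :=
    forall_congr' fun i => by rw [hxy i i.2]
  simp only [this]

/-- The extension of a pattern `p : S → X` by a background point `x₀`. [cite: LeeRaghavendraSteurer2015, §7.2 (p. 28)] -/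
def extendPattern [DecidableEq ι] (S : Finset ι) (p : S → X) (x₀ : ι → X) : ι → X :=
  fun i => if h : i ∈ S then p ⟨i, h⟩ else x₀ i

/-- **Cylinder decomposition of a junta**: an `S`-junta `g` satisfies
`g(x) = Σ_{p : S → X} 𝟙[x|_S = p] · g(p extended by x₀)` (exactly one term is nonzero).
[cite: LeeRaghavendraSteurer2015, §7.2 (p. 28: "any nonnegative S-junta is a nonnegative combination of the functions 𝟙_b")] -/
theorem IsSJunta.eq_sum_cylinderFn [DecidableEq ι] [Fintype X] {S : Finset ι} {g : (ι → X) → ℝ}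
    (hg : IsSJunta S g) (x₀ x : ι → X) :
    g x = ∑ p : S → X, cylinderFn S p x * g (extendPattern S p x₀) := by
  rw [Finset.sum_eq_single (fun i : S => x i)]
  · have h1 : cylinderFn S (fun i : S => x i) x = 1 := by simp [cylinderFn]
    rw [h1, one_mul]
    refine hg x _ fun i hi => ?_
    simp [extendPattern, hi]
  · intro p _ hp
    have : ¬ (∀ i : S, x i = p i) := by
      intro h; exact hp (funext fun i => (h i).symm)
    show (if (∀ i : S, x i = p i) then (1 : ℝ) else 0) * g (extendPattern S p x₀) = 0
    rw [if_neg this, zero_mul]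
  · intro h; exact absurd (mem_univ _) h

end Cylinders

/-! ### Local pseudo-densities and Lemma 7.1 -/

section PseudoDensity

variable {ι X : Type*} [Fintype ι] [DecidableEq ι] [Fintype X]

/-- `D` is a **`d`-local pseudo-density with respect to the measure `μ` on `X^ι`**: `E_μ D = 1` and
`E_{x∼μ} D(x) g(x) ≥ 0` for every nonnegative `d`-junta `g`.
[cite: LeeRaghavendraSteurer2015, §7.1 (p. 27)] -/
def IsLocalPseudoDensity (μ : (ι → X) → ℝ) (d : ℕ) (D : (ι → X) → ℝ) : Prop :=
  muExpect μ D = 1 ∧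
    ∀ g : (ι → X) → ℝ, IsKJunta d g → (∀ x, 0 ≤ g x) → 0 ≤ muExpect μ (fun x => D x * g x)

/-- A `d`-local pseudo-density is `d'`-local for `d' ≤ d`. [cite: LeeRaghavendraSteurer2015, §7.1 (p. 27)] -/
theorem IsLocalPseudoDensity.anti {μ : (ι → X) → ℝ} {d d' : ℕ} {D : (ι → X) → ℝ} (hd : d' ≤ d)
    (h : IsLocalPseudoDensity μ d D) : IsLocalPseudoDensity μ d' D :=
  ⟨h.1, fun g hg hg0 => h.2 g (hg.mono hd) hg0⟩

/-- A local pseudo-density is nonnegative against every certified function of its degree.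
[cite: LeeRaghavendraSteurer2015, Lemma 7.1 (p. 27)] -/
theorem IsLocalPseudoDensity.muExpect_mul_nonneg {μ : (ι → X) → ℝ} {d : ℕ} {D f : (ι → X) → ℝ}
    (hD : IsLocalPseudoDensity μ d D) (hf : HasJuntaCertificate d f) :
    0 ≤ muExpect μ (fun x => D x * f x) := by
  obtain ⟨k, g, hg, hg0, hfg⟩ := hf
  have : muExpect μ (fun x => D x * f x) = ∑ i, muExpect μ (fun x => D x * g i x) := by
    simp only [muExpect, hfg, mul_sum, sum_comm (s := univ (α := Fin k))]
  rw [this]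
  exact sum_nonneg fun i _ => hD.2 (g i) (hg i) (hg0 i)

/-- **Lemma 7.1, "if" direction** (for any measure): a `d`-local pseudo-density with `E_μ D f < 0`
rules out a certificate of degree `d`. [cite: LeeRaghavendraSteurer2015, Lemma 7.1 (p. 27)] -/
theorem not_hasJuntaCertificate_of_pseudoDensity {μ : (ι → X) → ℝ} {d : ℕ} {D f : (ι → X) → ℝ}
    (hD : IsLocalPseudoDensity μ d D) (hneg : muExpect μ (fun x => D x * f x) < 0) :
    ¬ HasJuntaCertificate d f :=
  fun hf => absurd (hD.muExpect_mul_nonneg hf) (not_le.mpr hneg)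

variable [DecidableEq X]

/-- The index set of the cylinder generators of degree `d`: pairs `(S, p)` with `|S| ≤ d`, `p : S → X`.
[cite: LeeRaghavendraSteurer2015, Lemma 7.1 (p. 27, proof: "closed convex cone")] -/
private abbrev CylIdx (ι X : Type*) [DecidableEq ι] (d : ℕ) :=
  Σ S : {S : Finset ι // S.card ≤ d}, ((S.1 : Finset ι) → X)

/-- The generator matrix: rows = points of the cube, columns = cylinders. [cite: LeeRaghavendraSteurer2015, Lemma 7.1 (p. 27, proof: "closed convex cone")] -/
private def cylMatrix (d : ℕ) : Matrix (ι → X) (CylIdx ι X d) ℝ :=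
  fun x c => cylinderFn c.1.1 c.2 x

omit [Fintype ι] [Fintype X] in
/-- Cylinder generators are `d`-juntas. [cite: LeeRaghavendraSteurer2015, Lemma 7.1 (p. 27, proof: "closed convex cone")] -/
private theorem isKJunta_cylinderFn {d : ℕ} (c : CylIdx ι X d) :
    IsKJunta d (cylinderFn (c.1.1 : Finset ι) c.2) :=
  ⟨c.1.1, c.1.2, isSJunta_cylinderFn _ _⟩

/-- A nonnegative combination of cylinders of degree `d` is a certificate of degree `d`. [cite: LeeRaghavendraSteurer2015, Lemma 7.1 (p. 27, proof: "closed convex cone")] -/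
private theorem hasJuntaCertificate_of_mulVec {d : ℕ} {f : (ι → X) → ℝ} {c : CylIdx ι X d → ℝ}
    (hc : 0 ≤ c) (hcf : cylMatrix d *ᵥ c = f) : HasJuntaCertificate d f := by
  have hf : ∀ x, f x = ∑ j, c j * cylinderFn (j.1.1 : Finset ι) j.2 x := by
    intro x
    rw [← hcf]
    simp only [mulVec, dotProduct, cylMatrix]
    exact sum_congr rfl fun j _ => mul_comm _ _
  have := hasJuntaCertificate_sum (d := d) (fun (j : CylIdx ι X d) x => c j * cylinderFn j.1.1 j.2 x)
    (fun j => (isKJunta_cylinderFn j).comp (fun t => c j * t))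
    (fun j x => mul_nonneg (hc j) (cylinderFn_nonneg _ _ _))
  simpa only [← hf] using this

/-- A functional nonnegative on all cylinders of degree `d` is nonnegative on all nonnegative `d`-juntas.
[cite: LeeRaghavendraSteurer2015, Lemma 7.1 (p. 27, proof: "closed convex cone")] -/
private theorem dotProduct_nonneg_of_vecMul {d : ℕ} {y : (ι → X) → ℝ} (hy : 0 ≤ y ᵥ* cylMatrix d)
    {g : (ι → X) → ℝ} (hg : IsKJunta d g) (hg0 : ∀ x, 0 ≤ g x) (x₀ : ι → X) : 0 ≤ y ⬝ᵥ g := by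
  obtain ⟨S, hS, hgS⟩ := hg
  have hexp : y ⬝ᵥ g = ∑ p : S → X, g (extendPattern S p x₀) * (y ᵥ* cylMatrix d) ⟨⟨S, hS⟩, p⟩ := by
    have h1 : y ⬝ᵥ g = ∑ x, ∑ p : S → X, y x * (cylinderFn S p x * g (extendPattern S p x₀)) := by
      unfold dotProduct
      refine sum_congr rfl fun x _ => ?_
      rw [hgS.eq_sum_cylinderFn x₀ x, mul_sum]
    rw [h1, sum_comm]
    refine sum_congr rfl fun p _ => ?_
    simp only [vecMul, dotProduct, cylMatrix, mul_sum]
    exact sum_congr rfl fun x _ => by ring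
  rw [hexp]
  exact sum_nonneg fun p _ => mul_nonneg (hg0 _) (hy _)

/-- **Lee–Raghavendra–Steurer 2015, Lemma 7.1 (junta degree versus local pseudo-densities), for a
measure of full support.**  For `μ > 0` pointwise on `X^ι`, `f : X^ι → ℝ` and `d ≥ 0`: `f` has NO
nonnegative junta certificate of degree `d` iff there is a `d`-local pseudo-density `D` (w.r.t. `μ`)
with `E_{x∼μ} D(x) f(x) < 0`.  Proof: the certified functions form the cone generated by the finitely
many cylinders `𝟙[x|_S = p]`, `|S| ≤ d`; Farkas' lemma [Schrijver1986, Cor. 7.1d] separates.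
[cite: LeeRaghavendraSteurer2015, Lemma 7.1 (p. 27)] -/
theorem LeeRaghavendraSteurer2015_lemma71_of_pos {μ : (ι → X) → ℝ} (hμ : ∀ x, 0 < μ x)
    (f : (ι → X) → ℝ) (d : ℕ) :
    ¬ HasJuntaCertificate d f ↔
      ∃ D : (ι → X) → ℝ, IsLocalPseudoDensity μ d D ∧ muExpect μ (fun x => D x * f x) < 0 := by
  refine ⟨fun hnot => ?_, fun ⟨D, hD, hneg⟩ => not_hasJuntaCertificate_of_pseudoDensity hD hneg⟩
  -- the cube is nonempty (otherwise `f` has the empty certificate)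
  rcases isEmpty_or_nonempty (ι → X) with hE | ⟨⟨x₀⟩⟩
  · exact absurd ⟨0, Fin.elim0, fun i => i.elim0, fun i => i.elim0, fun x => (hE.false x).elim⟩ hnot
  -- Farkas: `f` is not a nonnegative combination of the cylinder columns
  have hF := (Literature.Analysis.Convex.LPDuality.farkas_nonneg_eq (cylMatrix (ι := ι) (X := X) d) f)
  have hno : ¬ ∃ c : CylIdx ι X d → ℝ, 0 ≤ c ∧ cylMatrix d *ᵥ c = f :=
    fun ⟨c, hc, hcf⟩ => hnot (hasJuntaCertificate_of_mulVec hc hcf)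
  rw [hF] at hno
  push Not at hno
  obtain ⟨y, hy, hyf⟩ := hno
  -- the separating functional as a density: `D₀ = y/μ`
  set D₀ : (ι → X) → ℝ := fun x => y x / μ x with hD₀
  have hED₀ : ∀ g : (ι → X) → ℝ, muExpect μ (fun x => D₀ x * g x) = y ⬝ᵥ g := by
    intro g
    simp only [muExpect, dotProduct, hD₀]
    exact sum_congr rfl fun x _ => by field_simp [(hμ x).ne']
  have hpos : ∀ g, IsKJunta d g → (∀ x, 0 ≤ g x) → 0 ≤ muExpect μ (fun x => D₀ x * g x) := by
    intro g hg hg0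
    rw [hED₀]
    exact dotProduct_nonneg_of_vecMul hy hg hg0 x₀
  have hneg : muExpect μ (fun x => D₀ x * f x) < 0 := by rw [hED₀]; exact hyf
  -- normalisation: `E_μ D₀ = ⟨y, 1⟩ ≥ 0`
  have h1 : 0 ≤ muExpect μ D₀ := by
    have := hpos (fun _ => 1) ⟨∅, by simp, isSJunta_const ∅ 1⟩ (fun _ => zero_le_one)
    simpa using this
  rcases h1.eq_or_lt with h0 | hpos1
  · -- `⟨y,1⟩ = 0`: use `D = c + t·D₀` with `c = 1/Σμ` and `t` large
    have hμw : ∀ x, 0 ≤ μ x := fun x => (hμ x).le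
    have hZ : 0 < ∑ z, μ z := by
      calc (0 : ℝ) < μ x₀ := hμ x₀
        _ ≤ ∑ z, μ z := single_le_sum (fun z _ => hμw z) (mem_univ x₀)
    set a := muExpect μ (fun x => D₀ x * f x) with ha
    set b := muExpect μ f with hb
    set c : ℝ := 1 / ∑ z, μ z with hc
    have hc0 : 0 ≤ c := by positivity
    set t : ℝ := (|c * b| + 1) / (-a) with ht
    have htpos : 0 < t := div_pos (by positivity) (by linarith)
    have hta : t * a = -(|c * b| + 1) := by
      rw [ht]; field_simp [hneg.ne]
    refine ⟨fun x => c + t * D₀ x, ⟨?_, fun g hg hg0 => ?_⟩, ?_⟩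
    · -- E_μ D = 1
      have : muExpect μ (fun x => c + t * D₀ x) = (∑ z, μ z) * c + t * muExpect μ D₀ := by
        rw [muExpect_add, muExpect_const_mul]
        simp [muExpect, ← sum_mul]
      rw [this, ← h0, mul_zero, add_zero, hc, mul_one_div_cancel hZ.ne']
    · have hsplit : muExpect μ (fun x => (c + t * D₀ x) * g x) =
          c * muExpect μ g + t * muExpect μ (fun x => D₀ x * g x) := by
        rw [← muExpect_const_mul, ← muExpect_const_mul, ← muExpect_add]
        exact muExpect_congr fun x => by ring
      rw [hsplit]
      exact add_nonneg (mul_nonneg hc0 (sum_nonneg fun x _ => mul_nonneg (hμw x) (hg0 x)))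
        (mul_nonneg htpos.le (hpos g hg hg0))
    · have hsplit : muExpect μ (fun x => (c + t * D₀ x) * f x) = c * b + t * a := by
        rw [hb, ha, ← muExpect_const_mul, ← muExpect_const_mul, ← muExpect_add]
        exact muExpect_congr fun x => by ring
      rw [hsplit, hta]
      linarith [le_abs_self (c * b)]
  · -- `⟨y,1⟩ > 0`: rescale
    refine ⟨fun x => D₀ x / muExpect μ D₀, ⟨?_, fun g hg hg0 => ?_⟩, ?_⟩
    · have : muExpect μ (fun x => D₀ x / muExpect μ D₀) = muExpect μ D₀ / muExpect μ D₀ := by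
        simp only [muExpect, sum_div]
        exact sum_congr rfl fun x _ => by ring
      rw [this, div_self hpos1.ne']
    · have : muExpect μ (fun x => D₀ x / muExpect μ D₀ * g x) =
          muExpect μ (fun x => D₀ x * g x) / muExpect μ D₀ := by
        simp only [muExpect, sum_div]
        exact sum_congr rfl fun x _ => by ring
      rw [this]
      exact div_nonneg (hpos g hg hg0) hpos1.le
    · have : muExpect μ (fun x => D₀ x / muExpect μ D₀ * f x) =
          muExpect μ (fun x => D₀ x * f x) / muExpect μ D₀ := by
        simp only [muExpect, sum_div]
        exact sum_congr rfl fun x _ => by ring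
      rw [this]
      exact div_neg_of_neg_of_pos hneg hpos1

/-! #### The printed default: the uniform measure -/

omit [DecidableEq X] in
/-- **The uniform measure on `X^ι`** ("If a measure `μ` is unspecified, we always refer to the uniform
measure by default"). [cite: LeeRaghavendraSteurer2015, §7.1 (p. 27)] -/
def uniformWeight (ι X : Type*) [Fintype ι] [DecidableEq ι] [Fintype X] : (ι → X) → ℝ :=
  fun _ => 1 / (Fintype.card (ι → X) : ℝ)

omit [DecidableEq X] in
/-- The uniform measure has full support (for a nonempty alphabet). [cite: LeeRaghavendraSteurer2015, §7.1 (p. 27)] -/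
theorem uniformWeight_pos [Nonempty X] (x : ι → X) : 0 < uniformWeight ι X x := by
  unfold uniformWeight
  have : 0 < Fintype.card (ι → X) := Fintype.card_pos
  positivity

omit [DecidableEq X] in
/-- The uniform measure is a probability weight. [cite: LeeRaghavendraSteurer2015, §7.1 (p. 27)] -/
theorem isProbWeight_uniformWeight [Nonempty X] : IsProbWeight (uniformWeight ι X) where
  nonneg x := (uniformWeight_pos x).le
  sum_eq_one := by
    have : (0 : ℝ) < Fintype.card (ι → X) := by exact_mod_cast Fintype.card_pos
    simp only [uniformWeight, sum_const, card_univ, nsmul_eq_mul]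
    field_simp

/-- On the Boolean cube the uniform measure is the weight `2^{−m}` of `JuntaApproximation.lean`
(`muExpect_uniformCube`). [cite: LeeRaghavendraSteurer2015, §7.1 (p. 27)] -/
theorem uniformWeight_fin_bool (m : ℕ) : uniformWeight (Fin m) Bool = fun _ => (1 / 2 ^ m : ℝ) := by
  funext x
  simp [uniformWeight]

/-- **Lee–Raghavendra–Steurer 2015, Lemma 7.1 (as printed: uniform measure).**  For every
`f : Xⁿ → ℝ₊` and `d ≥ 0`: `juntadeg(f) > d` iff there is a `d`-local pseudo-density `D` (w.r.t. the
uniform measure) with `E_x D(x) f(x) < 0`. [cite: LeeRaghavendraSteurer2015, Lemma 7.1 (p. 27)] -/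
theorem LeeRaghavendraSteurer2015_lemma71 [Nonempty X] {f : (ι → X) → ℝ} (hf : ∀ x, 0 ≤ f x)
    (d : ℕ) :
    d < juntaDegree f ↔
      ∃ D : (ι → X) → ℝ, IsLocalPseudoDensity (uniformWeight ι X) d D ∧
        muExpect (uniformWeight ι X) (fun x => D x * f x) < 0 := by
  rw [lt_juntaDegree_iff hf]
  exact LeeRaghavendraSteurer2015_lemma71_of_pos uniformWeight_pos f d

end PseudoDensity


/-! ## Product measures, pattern matrices over a general alphabet, disintegration along `x_S`
(the bookkeeping of the proof of Theorem 7.2) -/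

section ProductMeasure

variable {X : Type*} [Fintype X]

/-- The product weight `Π_i μ(x_i)` on `X^ι` ("`μ^n` denotes the corresponding product measure on `Xⁿ`").
[cite: LeeRaghavendraSteurer2015, Thm 7.2 (p. 27)] -/
def piWeight {ι : Type*} [Fintype ι] (μ : X → ℝ) : (ι → X) → ℝ := fun x => ∏ i, μ (x i)

/-- The product measure `μ^k` on `X^k`. [cite: LeeRaghavendraSteurer2015, Thm 7.2 (p. 27)] -/
abbrev prodWeight (μ : X → ℝ) (k : ℕ) : (Fin k → X) → ℝ := piWeight μ

/-- `Σ_x Π_i μ(x_i) = (Σ_a μ(a))^{|ι|} = 1`. [cite: LeeRaghavendraSteurer2015, Thm 7.2 (p. 27)] -/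
theorem sum_piWeight {ι : Type*} [Fintype ι] [DecidableEq ι] {μ : X → ℝ} (hμ : IsProbWeight μ) :
    ∑ x : ι → X, piWeight (ι := ι) μ x = 1 := by
  have h := Finset.prod_univ_sum (fun _ : ι => (univ : Finset X)) (fun _ a => μ a)
  simp only [hμ.sum_eq_one, prod_const_one, Fintype.piFinset_univ] at h
  exact h.symm

/-- A product of a probability weight is a probability weight. [cite: LeeRaghavendraSteurer2015, Thm 7.2 (p. 27)] -/
theorem isProbWeight_piWeight {ι : Type*} [Fintype ι] [DecidableEq ι] {μ : X → ℝ}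
    (hμ : IsProbWeight μ) : IsProbWeight (piWeight (ι := ι) μ) where
  nonneg x := prod_nonneg fun i _ => hμ.nonneg (x i)
  sum_eq_one := sum_piWeight hμ

/-- The restriction `x_S ∈ X^m` of `x ∈ Xⁿ` to an `m`-subset `S` (coordinates in increasing order).
[cite: LeeRaghavendraSteurer2015, §1 (eq. (1.2)) and Thm 7.2 (p. 27: "D_S(x) = D(x_S)")] -/
def restrictFin {n m : ℕ} (S : {S : Finset (Fin n) // S.card = m}) (x : Fin n → X) : Fin m → X :=
  fun j => x (S.1.orderEmbOfFin S.2 j)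

/-- **The pattern matrix `M_n^f` over a general alphabet**: rows `S ∈ ([n] choose m)`, columns
`x ∈ Xⁿ`, entry `f(x_S)` (for `X = {0,1}` this is the tree's `patternMatrix`, `generalPatternMatrix_bool`).
[cite: LeeRaghavendraSteurer2015, Thm 7.2 (p. 27: "nnr(M_n^f)")] -/
def generalPatternMatrix (n : ℕ) {m : ℕ} (f : (Fin m → X) → ℝ) :
    {S : Finset (Fin n) // S.card = m} → (Fin n → X) → ℝ :=
  fun S x => f (restrictFin S x)

omit [Fintype X] in
/-- Over `{0,1}` the general pattern matrix is the tree's `patternMatrix`. [cite: LeeRaghavendraSteurer2015, §1 (eq. (1.2))] -/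
theorem generalPatternMatrix_bool {n m : ℕ} (f : (Fin m → Bool) → ℝ) :
    generalPatternMatrix n f = patternMatrix n f := rfl

variable {n m : ℕ}

/-- Gluing: the point of `Xⁿ` with `S`-coordinates read off `y ∈ X^m` (along the order isomorphism
`Fin m ≃ S`) and the remaining coordinates given by `b`. [cite: LeeRaghavendraSteurer2015, Thm 7.2 (p. 27, proof: "E[q̃_i(x) | x_S = y]")] -/
def glueFin (S : {S : Finset (Fin n) // S.card = m}) (y : Fin m → X) (b : {i // i ∉ S.1} → X) :
    Fin n → X :=
  fun i => if h : i ∈ S.1 then y ((S.1.orderIsoOfFin S.2).symm ⟨i, h⟩) else b ⟨i, h⟩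

/-- **Conditional average given `x_S = y`** under the product measure: `E_{x∼μⁿ}[G(x) | x_S = y] =
Σ_b (Π_{i∉S} μ(b_i)) · G(glue(y,b))`. [cite: LeeRaghavendraSteurer2015, Thm 7.2 (p. 27, proof: "E_{x∼μⁿ}[q̃_i(x) | x_S = y]")] -/
def condAvg (μ : X → ℝ) (S : {S : Finset (Fin n) // S.card = m}) (G : (Fin n → X) → ℝ)
    (y : Fin m → X) : ℝ :=
  ∑ b : {i // i ∉ S.1} → X, piWeight μ b * G (glueFin S y b)

omit [Fintype X] in
/-- Gluing then restricting returns `y`. [cite: LeeRaghavendraSteurer2015, Thm 7.2 (p. 27, proof)] -/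
theorem restrictFin_glueFin (S : {S : Finset (Fin n) // S.card = m}) (y : Fin m → X)
    (b : {i // i ∉ S.1} → X) : restrictFin S (glueFin S y b) = y := by
  funext j
  have hj : S.1.orderEmbOfFin S.2 j ∈ S.1 := Finset.orderEmbOfFin_mem _ _ j
  simp only [restrictFin, glueFin, hj, dite_true]
  congr 1
  rw [OrderIso.symm_apply_eq]
  exact Subtype.ext (Finset.coe_orderIsoOfFin_apply _ _ _).symm

/-- The conditional average of a nonnegative function is nonnegative. [cite: LeeRaghavendraSteurer2015, Thm 7.2 (p. 28, proof: "is a nonnegative (S ∩ J_i)-junta")] -/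
theorem condAvg_nonneg {μ : X → ℝ} (hμ : IsProbWeight μ) (S : {S : Finset (Fin n) // S.card = m})
    {G : (Fin n → X) → ℝ} (hG : ∀ x, 0 ≤ G x) (y : Fin m → X) : 0 ≤ condAvg μ S G y :=
  sum_nonneg fun b _ => mul_nonneg ((isProbWeight_piWeight hμ).nonneg b) (hG _)

/-- The conditional average of a constant. [cite: LeeRaghavendraSteurer2015, Thm 7.2 (p. 27, proof)] -/
theorem condAvg_const {μ : X → ℝ} (hμ : IsProbWeight μ) (S : {S : Finset (Fin n) // S.card = m})
    (c : ℝ) (y : Fin m → X) : condAvg μ S (fun _ => c) y = c := by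
  simp only [condAvg, ← sum_mul, sum_piWeight hμ, one_mul]

/-- Monotonicity / domination of conditional averages: `|E[G·h | x_S = y]| ≤ …` in the form
`condAvg (G) ≤ condAvg (G')` for `G ≤ G'`. [cite: LeeRaghavendraSteurer2015, Thm 7.2 (p. 27, proof)] -/
theorem condAvg_mono {μ : X → ℝ} (hμ : IsProbWeight μ) (S : {S : Finset (Fin n) // S.card = m})
    {G G' : (Fin n → X) → ℝ} (hGG' : ∀ x, G x ≤ G' x) (y : Fin m → X) :
    condAvg μ S G y ≤ condAvg μ S G' y :=
  sum_le_sum fun b _ => mul_le_mul_of_nonneg_left (hGG' _) ((isProbWeight_piWeight hμ).nonneg b)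

/-- The coordinates of `Fin m` that `S` sends into `J`: the junta set of `E[q̃ | x_S = ·]` for a
`J`-junta `q̃` ("`S ∩ J_i`", transported to `[m]`). [cite: LeeRaghavendraSteurer2015, Thm 7.2 (p. 28, proof)] -/
def pullbackSet (S : {S : Finset (Fin n) // S.card = m}) (J : Finset (Fin n)) : Finset (Fin m) :=
  univ.filter fun j => S.1.orderEmbOfFin S.2 j ∈ J

omit [Fintype X] in
/-- `|pullbackSet S J| ≤ |S ∩ J|`. [cite: LeeRaghavendraSteurer2015, Thm 7.2 (p. 28, proof)] -/
theorem card_pullbackSet_le (S : {S : Finset (Fin n) // S.card = m}) (J : Finset (Fin n)) :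
    (pullbackSet S J).card ≤ (S.1 ∩ J).card := by
  unfold pullbackSet
  refine Finset.card_le_card_of_injOn (fun j => S.1.orderEmbOfFin S.2 j) (fun j hj => ?_) ?_
  · simp only [coe_filter, mem_univ, true_and, Set.mem_setOf_eq] at hj
    exact mem_inter.mpr ⟨Finset.orderEmbOfFin_mem _ _ j, hj⟩
  · intro j _ j' _ h
    exact (S.1.orderEmbOfFin S.2).injective h

/-- **Junta transport**: if `G` is a `J`-junta then `y ↦ E[G | x_S = y]` is a junta on the coordinates
of `[m]` that `S` maps into `J`. [cite: LeeRaghavendraSteurer2015, Thm 7.2 (p. 28, proof: "the function y ↦ E_{x∼μⁿ}[q̃_i(x) | x_S = y] is a nonnegative (S ∩ J_i)-junta")] -/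
theorem isSJunta_condAvg (μ : X → ℝ) (S : {S : Finset (Fin n) // S.card = m}) {J : Finset (Fin n)}
    {G : (Fin n → X) → ℝ} (hG : IsSJunta J G) : IsSJunta (pullbackSet S J) (condAvg μ S G) := by
  intro y y' hyy'
  unfold condAvg
  refine sum_congr rfl fun b _ => ?_
  congr 1
  refine hG _ _ fun i hi => ?_
  unfold glueFin
  split_ifs with h
  · refine hyy' _ ?_
    simp only [pullbackSet, mem_filter, mem_univ, true_and]
    have : (S.1.orderEmbOfFin S.2 ((S.1.orderIsoOfFin S.2).symm ⟨i, h⟩) : Fin n) = i := by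
      rw [← Finset.coe_orderIsoOfFin_apply, OrderIso.apply_symm_apply]
    rw [this]; exact hi
  · rfl

/-- **Disintegration along `x_S`** (Fubini for the product measure): for `Φ : X^m → ℝ` and
`G : Xⁿ → ℝ`, `E_{x∼μⁿ}[Φ(x_S) G(x)] = E_{y∼μ^m}[Φ(y) · E[G | x_S = y]]`.
[cite: LeeRaghavendraSteurer2015, Thm 7.2 (p. 27, proof: "E_{x∼μⁿ} D_S(x) q̃_i(x) = E_{y∼μ^m} D_S(y) E_{x∼μⁿ}[q̃_i(x) | x_S = y]")] -/
theorem muExpect_restrictFin_mul (μ : X → ℝ) (S : {S : Finset (Fin n) // S.card = m})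
    (Φ : (Fin m → X) → ℝ) (G : (Fin n → X) → ℝ) :
    muExpect (prodWeight μ n) (fun x => Φ (restrictFin S x) * G x) =
      muExpect (prodWeight μ m) (fun y => Φ y * condAvg μ S G y) := by
  classical
  -- split `Xⁿ ≃ X^S × X^{Sᶜ}`
  set e := Equiv.piEquivPiSubtypeProd (fun i : Fin n => i ∈ S.1) (fun _ => X) with he
  -- the bijection `X^m ≃ X^S` along the order isomorphism `Fin m ≃o S`
  let κ : (Fin m → X) ≃ ({i // i ∈ S.1} → X) :=
    Equiv.piCongrLeft' (fun _ => X) (S.1.orderIsoOfFin S.2).toEquiv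
  have hκ_apply : ∀ (y : Fin m → X) (s : {i // i ∈ S.1}), κ y s = y ((S.1.orderIsoOfFin S.2).symm s) :=
    fun y s => rfl
  have hx : ∀ (a : {i // i ∈ S.1} → X) (b : {i // i ∉ S.1} → X) (i : Fin n),
      e.symm (a, b) i = if h : i ∈ S.1 then a ⟨i, h⟩ else b ⟨i, h⟩ := fun a b i => rfl
  -- the glued point is `e.symm (κ y, b)`
  have hglue : ∀ (y : Fin m → X) (b : {i // i ∉ S.1} → X), glueFin S y b = e.symm (κ y, b) := by
    intro y b; funext i; rw [hx]; rfl
  -- restriction of `e.symm (κ y, b)` is `y`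
  have hrestr : ∀ (y : Fin m → X) (b : {i // i ∉ S.1} → X), restrictFin S (e.symm (κ y, b)) = y := by
    intro y b; rw [← hglue, restrictFin_glueFin]
  -- the product weight splits
  have hweight : ∀ (a : {i // i ∈ S.1} → X) (b : {i // i ∉ S.1} → X),
      prodWeight μ n (e.symm (a, b)) = piWeight μ a * piWeight μ b := by
    intro a b
    unfold prodWeight piWeight
    rw [← Finset.prod_mul_prod_compl S.1 (fun i => μ (e.symm (a, b) i))]
    congr 1
    · rw [Finset.prod_subtype (F := inferInstance) S.1 (p := fun i => i ∈ S.1) (fun _ => Iff.rfl)]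
      exact Fintype.prod_congr _ _ fun i => by rw [hx, dif_pos i.2]
    · rw [Finset.prod_subtype (F := inferInstance) S.1ᶜ (p := fun i => i ∉ S.1)
        (fun i => by simp)]
      exact Fintype.prod_congr _ _ fun i => by rw [hx, dif_neg i.2]
  -- weight of `κ y` is `μ^m(y)`
  have hκw : ∀ y : Fin m → X, piWeight μ (κ y) = prodWeight μ m y := by
    intro y
    unfold prodWeight piWeight
    simp only [hκ_apply]
    exact Fintype.prod_equiv (S.1.orderIsoOfFin S.2).symm.toEquiv
      (fun s => μ (y ((S.1.orderIsoOfFin S.2).symm s))) (fun j => μ (y j)) (fun s => rfl)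
  -- compute
  set W : (Fin n → X) → ℝ := fun x => prodWeight μ n x * (Φ (restrictFin S x) * G x) with hW
  have step1 : ∑ x, W x = ∑ p : ({i // i ∈ S.1} → X) × ({i // i ∉ S.1} → X), W (e.symm p) :=
    (Fintype.sum_equiv e.symm (fun p => W (e.symm p)) W (fun _ => rfl)).symm
  have step2 : ∀ a : {i // i ∈ S.1} → X,
      (∑ b : {i // i ∉ S.1} → X, W (e.symm (a, b))) =
        piWeight μ a * (Φ (κ.symm a) * ∑ b : {i // i ∉ S.1} → X, piWeight μ b * G (e.symm (a, b))) := by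
    intro a
    rw [mul_sum, mul_sum]
    refine Fintype.sum_congr _ _ fun b => ?_
    have hra : restrictFin S (e.symm (a, b)) = κ.symm a := by
      have := hrestr (κ.symm a) b
      rwa [κ.apply_symm_apply] at this
    rw [hW]
    simp only []
    rw [hweight, hra]
    ring
  unfold muExpect
  rw [step1, Fintype.sum_prod_type]
  simp only [step2]
  rw [← Fintype.sum_equiv κ (fun y => piWeight μ (κ y) * (Φ (κ.symm (κ y)) *
      ∑ b : {i // i ∉ S.1} → X, piWeight μ b * G (e.symm (κ y, b)))) _ (fun _ => rfl)]
  refine Fintype.sum_congr _ _ fun y => ?_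
  rw [hκw, Equiv.symm_apply_apply]
  unfold condAvg
  simp only [hglue]

/-- Marginal on `S`: `E_{x∼μⁿ}[Φ(x_S)] = E_{y∼μ^m}[Φ(y)]`; in particular (eq. (7.5)) every row of
`M_n^f` has `μⁿ`-mean `E_{μ^m} f = ‖f‖₁`. [cite: LeeRaghavendraSteurer2015, Thm 7.2 (p. 27, eq. (7.5))] -/
theorem muExpect_restrictFin {μ : X → ℝ} (hμ : IsProbWeight μ) (S : {S : Finset (Fin n) // S.card = m})
    (Φ : (Fin m → X) → ℝ) :
    muExpect (prodWeight μ n) (fun x => Φ (restrictFin S x)) = muExpect (prodWeight μ m) Φ := by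
  have h := muExpect_restrictFin_mul μ S Φ (fun _ => 1)
  simp only [mul_one, condAvg_const hμ] at h
  exact h

/-- Row means of the pattern matrix: `E_{x∼μⁿ} M_n^f(S,x) = E_{μ^m} f`. [cite: LeeRaghavendraSteurer2015, Thm 7.2 (p. 27, eq. (7.5))] -/
theorem muExpect_generalPatternMatrix {μ : X → ℝ} (hμ : IsProbWeight μ)
    (S : {S : Finset (Fin n) // S.card = m}) (f : (Fin m → X) → ℝ) :
    muExpect (prodWeight μ n) (generalPatternMatrix n f S) = muExpect (prodWeight μ m) f :=
  muExpect_restrictFin hμ S f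

end ProductMeasure

/-! ## Planting estimate: a uniformly random `m`-subset rarely meets a small set in more than `d` points -/

section Planting

variable {n : ℕ}

/-- The `m`-subsets of `[n]` containing a fixed `T` are in bijection with the `(m − |T|)`-subsets of
`[n] ∖ T`. [cite: LeeRaghavendraSteurer2015, Thm 7.2 (p. 28, proof: the bound on "Pr(|S ∩ J_i| > d)")] -/
theorem card_filter_superset (m : ℕ) (T : Finset (Fin n)) (hT : T.card ≤ m) :
    ((powersetCard m (univ : Finset (Fin n))).filter fun S => T ⊆ S).card =
      (n - T.card).choose (m - T.card) := by
  have hB : (powersetCard (m - T.card) (univ \ T)).card = (n - T.card).choose (m - T.card) := by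
    rw [card_powersetCard, card_sdiff_of_subset (subset_univ T), card_univ, Fintype.card_fin]
  rw [← hB]
  refine card_bij' (fun S _ => S \ T) (fun U _ => U ∪ T) (fun S hS => ?_) (fun U hU => ?_)
    (fun S hS => ?_) (fun U hU => ?_)
  · simp only [mem_filter, mem_powersetCard] at hS
    simp only [mem_powersetCard]
    exact ⟨sdiff_subset_sdiff (subset_univ _) le_rfl, by rw [card_sdiff_of_subset hS.2, hS.1.2]⟩
  · simp only [mem_powersetCard] at hU
    have hdisj : Disjoint U T := by
      have := hU.1
      rw [subset_sdiff] at this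
      exact this.2
    simp only [mem_filter, mem_powersetCard, subset_univ, true_and]
    refine ⟨?_, subset_union_right⟩
    rw [card_union_of_disjoint hdisj, hU.2]
    omega
  · simp only [mem_filter, mem_powersetCard] at hS
    exact sdiff_union_of_subset hS.2
  · simp only [mem_powersetCard] at hU
    have hdisj : Disjoint U T := by
      have := hU.1
      rw [subset_sdiff] at this
      exact this.2
    rw [union_sdiff_right, Finset.sdiff_eq_self_iff_disjoint]
    exact hdisj

/-- Double counting: `Σ_{|S| = m} C(|S ∩ J|, k) = C(|J|, k) · C(n − k, m − k)` (pairs `T ⊆ S ∩ J`,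
`|T| = k`). [cite: LeeRaghavendraSteurer2015, Thm 7.2 (p. 28, proof)] -/
theorem sum_choose_card_inter (m k : ℕ) (hk : k ≤ m) (J : Finset (Fin n)) :
    ∑ S ∈ powersetCard m (univ : Finset (Fin n)), ((S ∩ J).card.choose k : ℕ) =
      J.card.choose k * (n - k).choose (m - k) := by
  have h1 : ∀ S : Finset (Fin n), (S ∩ J).card.choose k =
      ∑ T ∈ powersetCard k J, if T ⊆ S then 1 else 0 := by
    intro S
    rw [← card_powersetCard k (S ∩ J), ← Finset.card_filter]
    congr 1
    ext T
    simp only [mem_powersetCard, mem_filter, subset_inter_iff]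
    tauto
  simp_rw [h1]
  rw [sum_comm]
  have h2 : ∀ T ∈ powersetCard k J, (∑ S ∈ powersetCard m (univ : Finset (Fin n)),
      if T ⊆ S then (1 : ℕ) else 0) = (n - k).choose (m - k) := by
    intro T hT
    rw [mem_powersetCard] at hT
    rw [← Finset.card_filter, card_filter_superset m T (by omega), hT.2]
  rw [sum_congr rfl h2, sum_const, card_powersetCard, smul_eq_mul]

/-- The number of `m`-subsets `S ⊆ [n]` with `|S ∩ J| > d` is at most `C(|J|, d+1)·C(n−d−1, m−d−1)`.
[cite: LeeRaghavendraSteurer2015, Thm 7.2 (p. 28, proof: "Pr(|S ∩ J_i| > d) ≤ …")] -/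
theorem card_filter_inter_gt_le (m d : ℕ) (hd : d + 1 ≤ m) (J : Finset (Fin n)) :
    ((powersetCard m (univ : Finset (Fin n))).filter fun S => d < (S ∩ J).card).card ≤
      J.card.choose (d + 1) * (n - (d + 1)).choose (m - (d + 1)) := by
  rw [← sum_choose_card_inter m (d + 1) hd J, card_filter]
  refine sum_le_sum fun S _ => ?_
  split_ifs with h
  · exact Nat.succ_le_of_lt (Nat.choose_pos h)
  · exact Nat.zero_le _

/-- `C(n,m)·C(m,k) = C(n,k)·C(n−k,m−k)`, as a ratio: `C(n−k, m−k)/C(n,m) = C(m,k)/C(n,k)`.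
[cite: LeeRaghavendraSteurer2015, Thm 7.2 (p. 28, proof)] -/
theorem choose_sub_div_choose (m k : ℕ) (hk : k ≤ m) (hm : m ≤ n) :
    ((n - k).choose (m - k) : ℝ) / n.choose m = (m.choose k : ℝ) / n.choose k := by
  have h := Nat.choose_mul (n := n) hk
  have h1 : (0 : ℝ) < n.choose m := by exact_mod_cast Nat.choose_pos hm
  have h2 : (0 : ℝ) < n.choose k := by exact_mod_cast Nat.choose_pos (hk.trans hm)
  rw [div_eq_div_iff h1.ne' h2.ne']
  have := congrArg (Nat.cast (R := ℝ)) h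
  push_cast at this
  linarith

/-- `C(m,k)·n^k ≤ C(n,k)·m^k` for `m ≤ n` (i.e. `C(m,k)/C(n,k) = Π_{i<k} (m−i)/(n−i) ≤ (m/n)^k`).
[cite: LeeRaghavendraSteurer2015, Thm 7.2 (p. 28, proof: "≤ |J_i|^d m^d/(n−m)^d")] -/
theorem choose_mul_pow_le (m k : ℕ) (hmn : m ≤ n) : m.choose k * n ^ k ≤ n.choose k * m ^ k := by
  induction k with
  | zero => simp
  | succ k ih =>
    have hm := Nat.choose_succ_right_eq m k
    have hn' := Nat.choose_succ_right_eq n k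
    have hstep : (m - k) * n ≤ (n - k) * m := by
      rcases le_or_gt k m with hkm | hkm
      · rw [Nat.sub_mul, Nat.sub_mul]
        have h1 : k * m ≤ k * n := Nat.mul_le_mul_left k hmn
        rw [Nat.mul_comm m n]
        exact Nat.sub_le_sub_left h1 (n * m)
      · rw [Nat.sub_eq_zero_of_le hkm.le, zero_mul]; exact Nat.zero_le _
    -- compare `(k+1) · C(m,k+1) · n^{k+1}` with `(k+1) · C(n,k+1) · m^{k+1}`
    refine Nat.le_of_mul_le_mul_left (c := k + 1) ?_ (Nat.succ_pos k)
    calc (k + 1) * (m.choose (k + 1) * n ^ (k + 1))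
        = (m.choose (k + 1) * (k + 1)) * n ^ (k + 1) := by ring
      _ = m.choose k * (m - k) * n ^ (k + 1) := by rw [hm]
      _ = (m.choose k * n ^ k) * ((m - k) * n) := by ring
      _ ≤ (n.choose k * m ^ k) * ((m - k) * n) := Nat.mul_le_mul_right _ ih
      _ ≤ (n.choose k * m ^ k) * ((n - k) * m) := Nat.mul_le_mul_left _ hstep
      _ = (n.choose k * (n - k)) * m ^ (k + 1) := by ring
      _ = (n.choose (k + 1) * (k + 1)) * m ^ (k + 1) := by rw [hn']
      _ = (k + 1) * (n.choose (k + 1) * m ^ (k + 1)) := by ring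

/-- `C(m,k)/C(n,k) ≤ (m/n)^k` for `m ≤ n`, `n > 0`. [cite: LeeRaghavendraSteurer2015, Thm 7.2 (p. 28, proof)] -/
theorem choose_div_choose_le_pow (m k : ℕ) (hmn : m ≤ n) (hn : 0 < n) :
    (m.choose k : ℝ) / n.choose k ≤ ((m : ℝ) / n) ^ k := by
  have key : (m.choose k : ℝ) * (n : ℝ) ^ k ≤ (n.choose k : ℝ) * (m : ℝ) ^ k := by
    exact_mod_cast choose_mul_pow_le m k hmn
  have h2 : (0 : ℝ) < (n : ℝ) ^ k := by positivity
  by_cases hk : k ≤ n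
  · have h1 : (0 : ℝ) < n.choose k := by exact_mod_cast Nat.choose_pos hk
    rw [div_le_iff₀ h1, div_pow, div_mul_eq_mul_div, le_div_iff₀ h2]
    linarith [key]
  · have : m.choose k = 0 := Nat.choose_eq_zero_of_lt (by omega)
    rw [this]; simp only [Nat.cast_zero, zero_div]; positivity

end Planting

/-! ## Theorem 7.2 (lower bound): nonnegative rank of `M_n^f` versus approximate junta degree -/

section Theorem72

variable {X : Type*} [Fintype X]
variable {n m : ℕ}

/-- The uniform average over the `m`-subsets of `[n]` ("`E_S`", `S` uniform with `|S| = m`).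
[cite: LeeRaghavendraSteurer2015, Thm 7.2 (p. 27, proof: "E_{|S|=m} D_S")] -/
def subsetAvg (n m : ℕ) (g : {S : Finset (Fin n) // S.card = m} → ℝ) : ℝ :=
  (∑ S, g S) / (n.choose m : ℝ)

omit [Fintype X] in
/-- The number of `m`-subsets of `[n]` is `C(n,m)`. [cite: LeeRaghavendraSteurer2015, Thm 7.2 (p. 27, proof)] -/
theorem card_subsetsCard (n m : ℕ) : Fintype.card {S : Finset (Fin n) // S.card = m} = n.choose m := by
  rw [Fintype.card_finset_len, Fintype.card_fin]

omit [Fintype X] in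
/-- Linearity and monotonicity of `E_S`. [cite: LeeRaghavendraSteurer2015, Thm 7.2 (p. 27, proof)] -/
theorem subsetAvg_mono {g h : {S : Finset (Fin n) // S.card = m} → ℝ} (hgh : ∀ S, g S ≤ h S) :
    subsetAvg n m g ≤ subsetAvg n m h :=
  div_le_div_of_nonneg_right (sum_le_sum fun S _ => hgh S) (Nat.cast_nonneg _)

omit [Fintype X] in
/-- `E_S` of a constant (for `m ≤ n`). [cite: LeeRaghavendraSteurer2015, Thm 7.2 (p. 27, proof)] -/
theorem subsetAvg_const (hmn : m ≤ n) (c : ℝ) : subsetAvg n m (fun _ => c) = c := by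
  have hc : (0 : ℝ) < n.choose m := by exact_mod_cast Nat.choose_pos hmn
  simp only [subsetAvg, sum_const, card_univ, card_subsetsCard, nsmul_eq_mul]
  field_simp

omit [Fintype X] in
/-- `E_S` of a sum. [cite: LeeRaghavendraSteurer2015, Thm 7.2 (p. 27, proof)] -/
theorem subsetAvg_sum {ι : Type*} (s : Finset ι) (g : ι → {S : Finset (Fin n) // S.card = m} → ℝ) :
    subsetAvg n m (fun S => ∑ i ∈ s, g i S) = ∑ i ∈ s, subsetAvg n m (g i) := by
  simp only [subsetAvg, ← sum_div, Finset.sum_comm (s := s)]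

omit [Fintype X] in
/-- **The planting estimate, averaged form**: for weights `0 ≤ w(S) ≤ W` and `|J| ≤ K`,
`E_S[w(S)·𝟙(|S ∩ J| > d)] ≤ W·(K m/n)^{d+1}`. [cite: LeeRaghavendraSteurer2015, Thm 7.2 (p. 28, proof: "Pr(|S ∩ J_i| > d) ≤ …")] -/
theorem subsetAvg_mul_indicator_le (hmn : m ≤ n) (hn : 0 < n) (d : ℕ) (J : Finset (Fin n))
    {K : ℝ} (hJ : (J.card : ℝ) ≤ K) (w : {S : Finset (Fin n) // S.card = m} → ℝ) {W : ℝ}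
    (hw0 : ∀ S, 0 ≤ w S) (hwW : ∀ S, w S ≤ W) :
    subsetAvg n m (fun S => w S * if d < (S.1 ∩ J).card then 1 else 0) ≤
      W * (K * m / n) ^ (d + 1) := by
  have hC : (0 : ℝ) < n.choose m := by exact_mod_cast Nat.choose_pos hmn
  have hne : Nonempty {S : Finset (Fin n) // S.card = m} := by
    rw [← Fintype.card_pos_iff, card_subsetsCard]; exact Nat.choose_pos hmn
  obtain ⟨S₀⟩ := hne
  have hW : 0 ≤ W := (hw0 S₀).trans (hwW S₀)
  have hK : 0 ≤ K := (Nat.cast_nonneg _).trans hJ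
  have hbase : 0 ≤ K * m / n := by positivity
  -- bound the weights by `W`
  have h1 : subsetAvg n m (fun S => w S * if d < (S.1 ∩ J).card then 1 else 0) ≤
      subsetAvg n m (fun S => W * if d < (S.1 ∩ J).card then 1 else 0) :=
    subsetAvg_mono fun S => by
      split_ifs
      · simpa using hwW S
      · simp
  refine h1.trans ?_
  rcases lt_or_ge d m with hdm | hdm
  · -- `d + 1 ≤ m`: count the bad subsets
    have hd1 : d + 1 ≤ m := hdm
    have hcount := card_filter_inter_gt_le (n := n) m d hd1 J
    -- the average of the indicator is `#bad / C(n,m)`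
    have hsum : (∑ S : {S : Finset (Fin n) // S.card = m}, (if d < (S.1 ∩ J).card then (1 : ℝ) else 0)) =
        (((powersetCard m (univ : Finset (Fin n))).filter fun S => d < (S ∩ J).card).card : ℝ) := by
      rw [Finset.card_filter, Nat.cast_sum,
        Finset.sum_subtype (F := inferInstance) (powersetCard m (univ : Finset (Fin n)))
          (p := fun S : Finset (Fin n) => S.card = m) (fun S => by simp [mem_powersetCard])]
      exact Fintype.sum_congr _ _ fun S => by push_cast [Nat.cast_ite]; rfl
    have havg : subsetAvg n m (fun S => W * if d < (S.1 ∩ J).card then 1 else 0) =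
        W * ((((powersetCard m (univ : Finset (Fin n))).filter fun S => d < (S ∩ J).card).card : ℝ) /
          n.choose m) := by
      unfold subsetAvg
      rw [← mul_sum, hsum, mul_div_assoc]
    rw [havg]
    refine mul_le_mul_of_nonneg_left ?_ hW
    calc (((powersetCard m (univ : Finset (Fin n))).filter fun S => d < (S ∩ J).card).card : ℝ) /
          n.choose m
        ≤ (J.card.choose (d + 1) * (n - (d + 1)).choose (m - (d + 1)) : ℝ) / n.choose m := by
          gcongr; exact_mod_cast hcount
      _ = J.card.choose (d + 1) * ((m.choose (d + 1) : ℝ) / n.choose (d + 1)) := by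
          rw [mul_div_assoc, choose_sub_div_choose m (d + 1) hd1 hmn]
      _ ≤ (J.card : ℝ) ^ (d + 1) * (((m : ℝ) / n) ^ (d + 1)) := by
          gcongr
          · exact_mod_cast Nat.choose_le_pow J.card (d + 1)
          · exact choose_div_choose_le_pow m (d + 1) hmn hn
      _ ≤ K ^ (d + 1) * (((m : ℝ) / n) ^ (d + 1)) := by gcongr
      _ = (K * m / n) ^ (d + 1) := by rw [← mul_pow]; ring
  · -- `d ≥ m`: no `m`-subset meets `J` in more than `d` points
    have h0 : subsetAvg n m (fun S => W * if d < (S.1 ∩ J).card then 1 else 0) = 0 := by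
      unfold subsetAvg
      rw [sum_eq_zero, zero_div]
      intro S _
      have : ¬ d < (S.1 ∩ J).card := by
        have := card_le_card (inter_subset_left (s₁ := S.1) (s₂ := J))
        rw [S.2] at this
        omega
      simp [this]
    rw [h0]; positivity

/-- The relative entropy of a density bounded by `τ` is at most `log τ` ("`Λ_τ = {i : ‖q_i‖_∞ ≤ τ}`"
and `k' = O(‖D‖²_∞ (m/δ²) log τ)`). [cite: LeeRaghavendraSteurer2015, Thm 7.2 (p. 27, proof)] -/
theorem densityEntropy_le_log {α : Type*} [Fintype α] {μ : α → ℝ} (hμ : IsProbWeight μ)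
    {q : α → ℝ} (hq0 : ∀ x, 0 ≤ q x) (hq1 : muExpect μ q = 1) {τ : ℝ} (hqτ : ∀ x, q x ≤ τ) :
    densityEntropy μ q ≤ Real.log τ := by
  have h : densityEntropy μ q ≤ muExpect μ (fun x => q x * Real.log τ) := by
    unfold densityEntropy muExpect
    refine sum_le_sum fun x _ => mul_le_mul_of_nonneg_left ?_ (hμ.nonneg x)
    rcases (hq0 x).eq_or_lt with h0 | hpos
    · have hq : q x = 0 := h0.symm
      simp [hq]
    · exact mul_le_mul_of_nonneg_left (Real.log_le_log hpos (hqτ x)) (hq0 x)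
  have h2 : muExpect μ (fun x => q x * Real.log τ) = Real.log τ := by
    have : muExpect μ (fun x => q x * Real.log τ) = Real.log τ * muExpect μ q := by
      rw [← muExpect_const_mul]; exact muExpect_congr fun x => by ring
    rw [this, hq1, mul_one]
  linarith

omit [Fintype X] in
/-- A function of `x_S` is an `S`-junta. [cite: LeeRaghavendraSteurer2015, Thm 7.2 (p. 27, proof: "each D_S is clearly an m-junta")] -/
theorem isSJunta_comp_restrictFin (S : {S : Finset (Fin n) // S.card = m}) (Φ : (Fin m → X) → ℝ) :
    IsSJunta S.1 (fun x : Fin n → X => Φ (restrictFin S x)) := by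
  intro x y hxy
  show Φ (restrictFin S x) = Φ (restrictFin S y)
  congr 1
  funext j
  exact hxy _ (Finset.orderEmbOfFin_mem _ _ j)

/-- `|D(y)| ≤ ‖D‖_∞`. [cite: LeeRaghavendraSteurer2015, Thm 7.2 (p. 27, proof: "‖D‖_∞")] -/
theorem abs_apply_le_norm {α : Type*} [Fintype α] (D : α → ℝ) (y : α) : |D y| ≤ ‖D‖ := by
  rw [← Real.norm_eq_abs]; exact norm_le_pi_norm D y

/-- `E_{x∼μⁿ}[D(x_S) q(x)] ≥ −‖D‖_∞` for a density `q`. [cite: LeeRaghavendraSteurer2015, Thm 7.2 (p. 27, proof, eq. (7.9))] -/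
theorem muExpect_restrictFin_mul_ge_neg_norm {μ : X → ℝ} (hμ : IsProbWeight μ)
    (S : {S : Finset (Fin n) // S.card = m}) (D : (Fin m → X) → ℝ) {q : (Fin n → X) → ℝ}
    (hq0 : ∀ x, 0 ≤ q x) (hq1 : muExpect (prodWeight μ n) q = 1) :
    -‖D‖ ≤ muExpect (prodWeight μ n) (fun x => D (restrictFin S x) * q x) := by
  have h := (isProbWeight_piWeight (ι := Fin n) hμ).abs_muExpect_mul_le
    (g := fun x => D (restrictFin S x)) (fun x => abs_apply_le_norm D _) hq0
  rw [show muExpect (piWeight μ) q = 1 from hq1, mul_one] at h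
  exact (abs_le.mp h).1

/-- **The good columns** (the heart of the proof of Theorem 7.2): for a density `q` on `Xⁿ` (w.r.t.
`μⁿ`) with `‖q‖_∞ ≤ τ`, the junta approximation theorem (Thm 4.8, tests `−D_S`, accuracy `δ`) yields a
set `J` with `|J| ≤ (16/3)·m·log τ·‖D‖²_∞/δ²` such that for every `m`-subset `S`:
`E_{x∼μⁿ} D(x_S) q(x) ≥ −δ − ‖D‖_∞·𝟙[|S ∩ J| > d]` (the `d`-locality of `D` kills the junta part when
`|S ∩ J| ≤ d`). [cite: LeeRaghavendraSteurer2015, Thm 7.2 (p. 27–28, proof, eq. (7.7) and the display after (7.9))] -/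
theorem good_column_bound {μ : X → ℝ} (hμ : IsProbWeight μ) {d : ℕ} {D : (Fin m → X) → ℝ}
    (hD : IsLocalPseudoDensity (prodWeight μ m) d D) (hDpos : 0 < ‖D‖)
    {q : (Fin n → X) → ℝ} (hq0 : ∀ x, 0 ≤ q x) (hq1 : muExpect (prodWeight μ n) q = 1)
    {τ : ℝ} (hqτ : ∀ x, q x ≤ τ) {δ : ℝ} (hδ : 0 < δ) :
    ∃ J : Finset (Fin n), (J.card : ℝ) ≤ 16 / 3 * m * Real.log τ * ‖D‖ ^ 2 / δ ^ 2 ∧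
      ∀ S : {S : Finset (Fin n) // S.card = m},
        -δ - ‖D‖ * (if d < (S.1 ∩ J).card then 1 else 0) ≤
          muExpect (prodWeight μ n) (fun x => D (restrictFin S x) * q x) := by
  have hμn : IsProbWeight (prodWeight μ n) := isProbWeight_piWeight hμ
  have hμm : IsProbWeight (prodWeight μ m) := isProbWeight_piWeight hμ
  -- the test family `{−D_S}`
  set 𝒯 : Set ((Fin n → X) → ℝ) :=
    {g | ∃ S : {S : Finset (Fin n) // S.card = m}, g = fun x => -D (restrictFin S x)} with h𝒯
  have h𝒯k : ∀ g ∈ 𝒯, IsKJunta m g := by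
    rintro g ⟨S, rfl⟩
    exact ⟨S.1, S.2.le, (isSJunta_comp_restrictFin S D).comp (fun t => -t)⟩
  have h𝒯Δ : ∀ g ∈ 𝒯, ∀ x, |g x| ≤ ‖D‖ := by
    rintro g ⟨S, rfl⟩ x
    simp only [abs_neg]
    exact abs_apply_le_norm D _
  obtain ⟨k', q', hk', ⟨J, hJk', hJq'⟩, hq'0, hq'1, hgood⟩ :=
    LeeRaghavendraSteurer2015_thm48 hμn hq0 hq1 𝒯 h𝒯k hDpos h𝒯Δ hδ
  have hEnt := densityEntropy_le_log hμn hq0 hq1 hqτ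
  refine ⟨J, ?_, fun S => ?_⟩
  · calc (J.card : ℝ) ≤ k' := by exact_mod_cast hJk'
      _ ≤ 16 / 3 * m * densityEntropy (prodWeight μ n) q * ‖D‖ ^ 2 / δ ^ 2 := hk'
      _ ≤ 16 / 3 * m * Real.log τ * ‖D‖ ^ 2 / δ ^ 2 := by gcongr
  · -- the test `−D_S` distinguishes by at most `δ`
    have htest := hgood (fun x => -D (restrictFin S x)) ⟨S, rfl⟩
    have hsplit : muExpect (prodWeight μ n) (fun x => -D (restrictFin S x) * (q x - q' x)) =
        muExpect (prodWeight μ n) (fun x => D (restrictFin S x) * q' x) -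
          muExpect (prodWeight μ n) (fun x => D (restrictFin S x) * q x) := by
      rw [← muExpect_sub]; exact muExpect_congr fun x => by ring
    rw [hsplit] at htest
    -- the junta part, disintegrated along `x_S`
    have hfub := muExpect_restrictFin_mul μ S D q'
    have hcond0 : ∀ y, 0 ≤ condAvg μ S q' y := condAvg_nonneg hμ S hq'0
    have hjunta : IsSJunta (pullbackSet S J) (condAvg μ S q') := isSJunta_condAvg μ S hJq'
    split_ifs with hbad
    · -- `|S ∩ J| > d`: only the trivial bound `≥ −‖D‖`
      have h1 := muExpect_restrictFin_mul_ge_neg_norm hμ S D hq'0 hq'1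
      linarith
    · -- `|S ∩ J| ≤ d`: `E[q' | x_S]` is a nonnegative `d`-junta, so `D` is nonnegative against it
      have hk : IsKJunta d (condAvg μ S q') :=
        ⟨pullbackSet S J, (card_pullbackSet_le S J).trans (not_lt.mp hbad), hjunta⟩
      have h2 : 0 ≤ muExpect (prodWeight μ m) (fun y => D y * condAvg μ S q' y) :=
        hD.2 _ hk hcond0
      rw [← hfub] at h2
      linarith

/-- The hypothesis `E_{μ^m}[D f] < −ε‖D‖_∞‖f‖₁` of Theorem 7.2 forces `‖f‖₁ > 0`, `‖D‖_∞ > 0`,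
`ε < 1`, `m ≥ 1` and of course `‖f‖₁ ≤ ‖f‖_∞`. [cite: LeeRaghavendraSteurer2015, Thm 7.2 (p. 27, the definition of juntadeg^ε)] -/
theorem thm72_hypothesis_pos {μ : X → ℝ} (hμ : IsProbWeight μ) {d : ℕ}
    {f : (Fin m → X) → ℝ} (hf : ∀ y, 0 ≤ f y) {ε : ℝ} (hε : 0 < ε)
    {D : (Fin m → X) → ℝ} (hD : IsLocalPseudoDensity (prodWeight μ m) d D)
    (hDf : muExpect (prodWeight μ m) (fun y => D y * f y) <
      -(ε * ‖D‖ * muExpect (prodWeight μ m) f)) :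
    0 < muExpect (prodWeight μ m) f ∧ 0 < ‖D‖ ∧ ε < 1 ∧ 0 < m ∧
      muExpect (prodWeight μ m) f ≤ ‖f‖ := by
  have hμm : IsProbWeight (prodWeight μ m) := isProbWeight_piWeight hμ
  set F₁ := muExpect (prodWeight μ m) f with hF₁
  set A := muExpect (prodWeight μ m) (fun y => D y * f y) with hA
  have hF₁0 : 0 ≤ F₁ := hμm.muExpect_nonneg hf
  have hAabs : |A| ≤ ‖D‖ * F₁ := hμm.abs_muExpect_mul_le (fun y => abs_apply_le_norm D y) hf
  have hAlow : -(‖D‖ * F₁) ≤ A := (abs_le.mp hAabs).1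
  have hDF : 0 < ‖D‖ * F₁ := by
    by_contra h
    have h0 : ‖D‖ * F₁ = 0 := le_antisymm (not_lt.mp h) (mul_nonneg (norm_nonneg _) hF₁0)
    have h1 : ε * ‖D‖ * F₁ = 0 := by rw [mul_assoc, h0, mul_zero]
    rw [h1, neg_zero] at hDf
    rw [h0] at hAabs
    linarith [abs_nonneg A, (abs_le.mp hAabs).1]
  have hDpos : 0 < ‖D‖ := by
    rcases (norm_nonneg D).eq_or_lt with h | h
    · rw [← h, zero_mul] at hDF; exact absurd hDF (lt_irrefl 0)
    · exact h
  have hF₁pos : 0 < F₁ := by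
    rcases hF₁0.eq_or_lt with h | h
    · rw [← h, mul_zero] at hDF; exact absurd hDF (lt_irrefl 0)
    · exact h
  have hε1 : ε < 1 := by
    have : ε * (‖D‖ * F₁) < 1 * (‖D‖ * F₁) := by nlinarith
    exact lt_of_mul_lt_mul_right this hDF.le
  have hfF : F₁ ≤ ‖f‖ := by
    calc F₁ = muExpect (prodWeight μ m) f := rfl
      _ ≤ muExpect (prodWeight μ m) (fun _ => ‖f‖) :=
          hμm.muExpect_mono fun y => (le_abs_self _).trans (abs_apply_le_norm f y)
      _ = ‖f‖ := hμm.muExpect_const _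
  -- `m ≥ 1`: on `X^0` both `D` and `f` are constants and `A = f(pt) ≥ 0`
  have hm : 0 < m := by
    by_contra h
    have hm0 : m = 0 := by omega
    subst hm0
    set c₀ : Fin 0 → X := fun i => i.elim0
    have hfc : ∀ y : Fin 0 → X, f y = f c₀ := fun y => congrArg f (funext fun i => i.elim0)
    have hA0 : A = f c₀ := by
      calc A = muExpect (prodWeight μ 0) (fun y => f c₀ * D y) :=
            muExpect_congr fun y => by rw [hfc y, mul_comm]
        _ = f c₀ * muExpect (prodWeight μ 0) D := muExpect_const_mul _ _ _
        _ = f c₀ := by rw [hD.1, mul_one]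
    have : 0 ≤ A := hA0 ▸ hf c₀
    have : 0 < ε * ‖D‖ * F₁ := by positivity
    linarith
  exact ⟨hF₁pos, hDpos, hε1, hm, hfF⟩

/-- **Lee–Raghavendra–Steurer 2015, Theorem 7.2 — the lower bound, in the form its proof delivers.**
Let `X` be a finite alphabet with a probability measure `μ`, `f : X^m → ℝ₊`, `n ≥ 2m`, `ε > 0`, and let
`D` be a `d`-local pseudo-density w.r.t. `μ^m` with `E_{μ^m}[D f] < −ε‖D‖_∞ E_{μ^m} f` (i.e.
`juntadeg^ε(f; μ^m) > d`).  If `M_n^f` has a nonnegative factorisation of size `r`, then with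
`τ = 3r‖f‖_∞/(ε‖f‖₁)`:  `r > (ε/3)·(ε² n/(48 m² log τ))^{d+1}`.
See the module docstring for the relation to the printed bound `(cε²n/(m²(d log n + log(‖f‖_∞/‖f‖₁))))^d`
(the printed proof's choice "`τ = 3r‖f‖_∞/‖f‖₁`" must carry the factor `1/ε`, which is what produces
the prefactor `ε/3` and the `log(1/ε)` inside `log τ` here; the exponent `d+1` is what the planting
estimate gives).  Proof = the printed one: normalise the columns to densities `q_i` (eq. (7.4)–(7.5)),
split by `‖q_i‖_∞ ≤ τ` (eq. (7.6)), approximate the bounded columns by juntas against the tests `D_S`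
(Thm 4.8, eq. (7.7)), test both sides of the factorisation against `E_S D_S` (eq. (7.8)–(7.9)) and use
`d`-locality plus the planting estimate. [cite: LeeRaghavendraSteurer2015, Thm 7.2 (p. 27–28)] -/
theorem LeeRaghavendraSteurer2015_thm72_lower {μ : X → ℝ} (hμ : IsProbWeight μ) {d r : ℕ}
    (hn : 2 * m ≤ n) {f : (Fin m → X) → ℝ} (hf : ∀ y, 0 ≤ f y) {ε : ℝ} (hε : 0 < ε)
    {D : (Fin m → X) → ℝ} (hD : IsLocalPseudoDensity (prodWeight μ m) d D)
    (hDf : muExpect (prodWeight μ m) (fun y => D y * f y) <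
      -(ε * ‖D‖ * muExpect (prodWeight μ m) f))
    (hr : HasNonnegFactorization (generalPatternMatrix n f) r) :
    ε / 3 * (ε ^ 2 * n / (48 * (m : ℝ) ^ 2 *
      Real.log (3 * r * ‖f‖ / (ε * muExpect (prodWeight μ m) f)))) ^ (d + 1) < r := by
  have hμn : IsProbWeight (prodWeight μ n) := isProbWeight_piWeight hμ
  have hμm : IsProbWeight (prodWeight μ m) := isProbWeight_piWeight hμ
  set F₁ := muExpect (prodWeight μ m) f with hF₁
  set A := muExpect (prodWeight μ m) (fun y => D y * f y) with hA
  -- basic positivity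
  obtain ⟨hF₁pos, hDpos, hε1, hm, hfF⟩ := thm72_hypothesis_pos hμ hf hε hD hDf
  have hDF : 0 < ‖D‖ * F₁ := mul_pos hDpos hF₁pos
  have hfpos : 0 < ‖f‖ := hF₁pos.trans_le hfF
  have hn0 : 0 < n := by omega
  have hmn : m ≤ n := by omega
  have hne : Nonempty {S : Finset (Fin n) // S.card = m} := by
    rw [← Fintype.card_pos_iff, card_subsetsCard]; exact Nat.choose_pos hmn
  -- the factorisation
  obtain ⟨U, V, hU, hV, hM⟩ := hr
  -- row means (eq. (7.5)) and the tested identity (eq. (7.8))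
  have hrow : ∀ S : {S : Finset (Fin n) // S.card = m},
      (∑ l, U S l * muExpect (prodWeight μ n) (V l)) = F₁ := by
    intro S
    rw [hF₁, ← muExpect_generalPatternMatrix hμ S f]
    simp only [muExpect, mul_sum]
    rw [sum_comm]
    refine sum_congr rfl fun x _ => ?_
    rw [hM S x, mul_sum]
    exact sum_congr rfl fun l _ => by ring
  have htest : ∀ S : {S : Finset (Fin n) // S.card = m},
      (∑ l, U S l * muExpect (prodWeight μ n) (fun x => D (restrictFin S x) * V l x)) = A := by
    intro S
    rw [hA, ← muExpect_restrictFin hμ S (fun y => D y * f y)]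
    simp only [muExpect, mul_sum]
    rw [sum_comm]
    refine sum_congr rfl fun x _ => ?_
    have : f (restrictFin S x) = ∑ l, U S l * V l x := hM S x
    rw [this, mul_sum, mul_sum]
    exact sum_congr rfl fun l _ => by ring
  -- `r ≥ 1`
  have hr1 : 1 ≤ r := by
    by_contra h
    have hr0 : r = 0 := by omega
    subst hr0
    obtain ⟨S⟩ := hne
    have := hrow S
    simp at this
    linarith
  have hrpos : (0 : ℝ) < r := by exact_mod_cast hr1
  -- parameters
  set τ : ℝ := 3 * r * ‖f‖ / (ε * F₁) with hτ
  set δ : ℝ := ε * ‖D‖ / 3 with hδ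
  have hδpos : 0 < δ := by positivity
  have hτ1 : 1 < τ := by
    rw [hτ, lt_div_iff₀ (by positivity)]
    have : (1 : ℝ) ≤ r := by exact_mod_cast hr1
    nlinarith
  have hτpos : 0 < τ := zero_lt_one.trans hτ1
  have hlogτ : 0 < Real.log τ := Real.log_pos hτ1
  set K : ℝ := 16 / 3 * m * Real.log τ * ‖D‖ ^ 2 / δ ^ 2 with hK
  have hK48 : K = 48 * m * Real.log τ / ε ^ 2 := by
    rw [hK, hδ]; field_simp; ring
  have hKpos : 0 < K := by
    rw [hK48]
    have : (0 : ℝ) < m := by exact_mod_cast hm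
    positivity
  set P : ℝ := (K * m / n) ^ (d + 1) with hP
  have hbpos : 0 < K * m / n := by
    have : (0 : ℝ) < m := by exact_mod_cast hm
    have : (0 : ℝ) < n := by exact_mod_cast hn0
    positivity
  have hPpos : 0 < P := pow_pos hbpos _
  -- column means and weights
  set e : Fin r → ℝ := fun l => muExpect (prodWeight μ n) (V l) with he
  have he0 : ∀ l, 0 ≤ e l := fun l => hμn.muExpect_nonneg (hV l)
  set lam : Fin r → {S : Finset (Fin n) // S.card = m} → ℝ := fun l S => U S l * e l with hlam
  have hlam0 : ∀ l S, 0 ≤ lam l S := fun l S => mul_nonneg (hU S l) (he0 l)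
  have hlamsum : ∀ S, ∑ l, lam l S = F₁ := fun S => hrow S
  have hlamF : ∀ l S, lam l S ≤ F₁ := fun l S => by
    rw [← hlamsum S]
    exact single_le_sum (f := fun l => lam l S) (fun l _ => hlam0 l S) (mem_univ l)
  set T : Fin r → ℝ := fun l => subsetAvg n m (fun S => U S l *
      muExpect (prodWeight μ n) (fun x => D (restrictFin S x) * V l x)) with hT
  -- (1) `Σ_l T l = A`
  have hsumT : ∑ l, T l = A := by
    have h := (subsetAvg_sum (n := n) (m := m) (univ : Finset (Fin r)) (fun l S => U S l *
      muExpect (prodWeight μ n) (fun x => D (restrictFin S x) * V l x))).symm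
    simp only [hT]
    rw [h]
    simp only [htest]
    exact subsetAvg_const hmn A
  -- (2) the per-column lower bound
  have hcol : ∀ l, -(‖D‖ * ‖f‖ / τ + δ * subsetAvg n m (lam l) + ‖D‖ * F₁ * P) ≤ T l := by
    intro l
    have havg0 : 0 ≤ subsetAvg n m (lam l) :=
      div_nonneg (sum_nonneg fun S _ => hlam0 l S) (Nat.cast_nonneg _)
    have hpos1 : 0 ≤ ‖D‖ * ‖f‖ / τ := by positivity
    have hpos2 : 0 ≤ δ * subsetAvg n m (lam l) := mul_nonneg hδpos.le havg0
    have hpos3 : 0 ≤ ‖D‖ * F₁ * P := by positivity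
    rcases (he0 l).eq_or_lt with hel | hel
    · -- a `μⁿ`-null column contributes nothing
      have hnull : ∀ x, prodWeight μ n x * V l x = 0 := by
        have hs : ∑ x, prodWeight μ n x * V l x = 0 := hel.symm
        exact fun x => (sum_eq_zero_iff_of_nonneg (fun x _ =>
          mul_nonneg (hμn.nonneg x) (hV l x))).mp hs x (mem_univ x)
      have hTl : T l = 0 := by
        rw [hT]
        simp only
        have : ∀ S : {S : Finset (Fin n) // S.card = m},
            muExpect (prodWeight μ n) (fun x => D (restrictFin S x) * V l x) = 0 := by
          intro S
          unfold muExpect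
          exact sum_eq_zero fun x _ => by
            rw [show prodWeight μ n x * (D (restrictFin S x) * V l x) =
              D (restrictFin S x) * (prodWeight μ n x * V l x) by ring, hnull, mul_zero]
        simp only [this, mul_zero]
        unfold subsetAvg; simp
      rw [hTl]
      linarith
    · -- normalise the column to a density `q`
      set q : (Fin n → X) → ℝ := fun x => V l x / e l with hq
      have hq0 : ∀ x, 0 ≤ q x := fun x => div_nonneg (hV l x) hel.le
      have hq1 : muExpect (prodWeight μ n) q = 1 := by
        rw [hq]
        unfold muExpect
        simp_rw [mul_div_assoc', ← sum_div]
        exact div_self hel.ne'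
      have hVq : ∀ x, V l x = e l * q x := fun x => by rw [hq]; field_simp
      have hUV : ∀ S : {S : Finset (Fin n) // S.card = m},
          U S l * muExpect (prodWeight μ n) (fun x => D (restrictFin S x) * V l x) =
            lam l S * muExpect (prodWeight μ n) (fun x => D (restrictFin S x) * q x) := by
        intro S
        have hE : muExpect (prodWeight μ n) (fun x => D (restrictFin S x) * V l x) =
            e l * muExpect (prodWeight μ n) (fun x => D (restrictFin S x) * q x) := by
          rw [← muExpect_const_mul]
          exact muExpect_congr fun x => by rw [hVq x]; ring
        rw [hE, hlam]
        ring
      have hTl : T l = subsetAvg n m (fun S => lam l S *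
          muExpect (prodWeight μ n) (fun x => D (restrictFin S x) * q x)) := by
        rw [hT]; simp only [hUV]
      by_cases hbad : ∃ x, τ < q x
      · -- a column with `‖q‖_∞ > τ`: its weights are `≤ ‖f‖_∞/τ` (eq. (7.6))
        obtain ⟨x₀, hx₀⟩ := hbad
        have hlamτ : ∀ S, lam l S ≤ ‖f‖ / τ := by
          intro S
          have h1 : lam l S * q x₀ ≤ ‖f‖ := by
            have : lam l S * q x₀ = U S l * V l x₀ := by
              rw [hlam, hq]; simp only; field_simp
            rw [this]
            calc U S l * V l x₀ ≤ ∑ l', U S l' * V l' x₀ :=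
                  single_le_sum (f := fun l' => U S l' * V l' x₀)
                    (fun l' _ => mul_nonneg (hU S l') (hV l' x₀)) (mem_univ l)
              _ = f (restrictFin S x₀) := (hM S x₀).symm
              _ ≤ ‖f‖ := (le_abs_self _).trans (abs_apply_le_norm f _)
          have hqpos : 0 < q x₀ := hτpos.trans hx₀
          calc lam l S ≤ ‖f‖ / q x₀ := by rw [le_div_iff₀ hqpos]; exact h1
            _ ≤ ‖f‖ / τ := div_le_div_of_nonneg_left (norm_nonneg _) hτpos hx₀.le
        have hTge : -(‖D‖ * ‖f‖ / τ) ≤ T l := by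
          rw [hTl, ← subsetAvg_const (n := n) (m := m) hmn (-(‖D‖ * ‖f‖ / τ))]
          refine subsetAvg_mono fun S => ?_
          have h1 := muExpect_restrictFin_mul_ge_neg_norm hμ S D hq0 hq1
          have h2 := hlamτ S
          have h3 := hlam0 l S
          have h4 : ‖D‖ * lam l S ≤ ‖D‖ * (‖f‖ / τ) := mul_le_mul_of_nonneg_left h2 (norm_nonneg _)
          calc -(‖D‖ * ‖f‖ / τ) ≤ -(‖D‖ * lam l S) := by rw [mul_div_assoc]; exact neg_le_neg h4
            _ = lam l S * (-‖D‖) := by ring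
            _ ≤ lam l S * muExpect (prodWeight μ n) (fun x => D (restrictFin S x) * q x) :=
                mul_le_mul_of_nonneg_left h1 h3
        linarith
      · -- a column with `‖q‖_∞ ≤ τ`: junta approximation (Thm 4.8) and `d`-locality
        push Not at hbad
        obtain ⟨J, hJK, hJ⟩ := good_column_bound hμ hD hDpos hq0 hq1 hbad hδpos
        have hplant := subsetAvg_mul_indicator_le (n := n) (m := m) hmn hn0 d J hJK (lam l)
          (hlam0 l) (hlamF l)
        have hTge : -(δ * subsetAvg n m (lam l)) -
            ‖D‖ * subsetAvg n m (fun S => lam l S * if d < (S.1 ∩ J).card then 1 else 0) ≤ T l := by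
          have hlin : -(δ * subsetAvg n m (lam l)) -
              ‖D‖ * subsetAvg n m (fun S => lam l S * if d < (S.1 ∩ J).card then 1 else 0) =
              subsetAvg n m (fun S => lam l S *
                (-δ - ‖D‖ * if d < (S.1 ∩ J).card then 1 else 0)) := by
            unfold subsetAvg
            rw [mul_div_assoc', mul_div_assoc', ← neg_div, ← sub_div, mul_sum, mul_sum,
              ← sum_neg_distrib, ← sum_sub_distrib]
            congr 1
            exact sum_congr rfl fun S _ => by ring
          rw [hlin, hTl]
          exact subsetAvg_mono fun S => mul_le_mul_of_nonneg_left (hJ S) (hlam0 l S)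
        have : ‖D‖ * subsetAvg n m (fun S => lam l S * if d < (S.1 ∩ J).card then 1 else 0) ≤
            ‖D‖ * (F₁ * P) := mul_le_mul_of_nonneg_left hplant (norm_nonneg _)
        linarith
  -- (3) assemble: `A = Σ_l T l ≥ −(r‖D‖‖f‖/τ + δ F₁ + r ‖D‖ F₁ P)`
  have hsumlam : ∑ l, subsetAvg n m (lam l) = F₁ := by
    rw [← subsetAvg_sum (n := n) (m := m) univ lam]
    simp only [hlamsum]
    exact subsetAvg_const hmn F₁
  have hAge : -(r * (‖D‖ * ‖f‖ / τ) + δ * F₁ + r * (‖D‖ * F₁ * P)) ≤ A := by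
    rw [← hsumT]
    have h := sum_le_sum fun l (_ : l ∈ (univ : Finset (Fin r))) => hcol l
    have hs : ∑ l : Fin r, -(‖D‖ * ‖f‖ / τ + δ * subsetAvg n m (lam l) + ‖D‖ * F₁ * P) =
        -(r * (‖D‖ * ‖f‖ / τ) + δ * F₁ + r * (‖D‖ * F₁ * P)) := by
      rw [sum_neg_distrib, sum_add_distrib, sum_add_distrib, sum_const, sum_const, card_univ,
        Fintype.card_fin, ← mul_sum, hsumlam]
      simp only [nsmul_eq_mul]
    rw [hs] at h
    exact h
  -- the two choices `τ = 3r‖f‖/(ε‖f‖₁)` and `δ = ε‖D‖/3`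
  have hterm1 : r * (‖D‖ * ‖f‖ / τ) = ε * ‖D‖ * F₁ / 3 := by
    rw [hτ]; field_simp
  have hterm2 : δ * F₁ = ε * ‖D‖ * F₁ / 3 := by rw [hδ]; ring
  rw [hterm1, hterm2] at hAge
  -- hence `r P > ε/3`
  have hrP : ε / 3 < r * P := by
    have h1 : ε * ‖D‖ * F₁ / 3 < r * (‖D‖ * F₁ * P) := by linarith
    have h2 : ε / 3 * (‖D‖ * F₁) < r * P * (‖D‖ * F₁) := by linarith
    exact lt_of_mul_lt_mul_right h2 hDF.le
  -- rewrite the base of the printed expression as `(K m/n)⁻¹`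
  have hbase : ε ^ 2 * n / (48 * (m : ℝ) ^ 2 * Real.log τ) = (K * m / n)⁻¹ := by
    rw [hK48]
    have : (0 : ℝ) < m := by exact_mod_cast hm
    have : (0 : ℝ) < n := by exact_mod_cast hn0
    field_simp
  rw [hP] at hrP
  rw [hbase, inv_pow, ← div_eq_mul_inv, div_lt_iff₀ (pow_pos hbpos _)]
  exact hrP

/-- **Lee–Raghavendra–Steurer 2015, Theorem 7.2 (lower bound), in the printed two-regime shape.**
Under the hypotheses of `LeeRaghavendraSteurer2015_thm72_lower`: either `nnr ≥ n^{d+1}` ("if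
`r ≥ n^d`, then we are done"), or
`r > (ε/3)·(ε² n / (48 m² ((d+1) log n + log(‖f‖_∞/‖f‖₁) + log(3/ε))))^{d+1}` — the printed
"`(c ε² n/(m²(d log n + log(‖f‖_∞/‖f‖₁))))^d`" up to the recorded `ε`-bookkeeping (prefactor `ε/3`,
summand `log(3/ε)`) and the exponent `d+1`. [cite: LeeRaghavendraSteurer2015, Thm 7.2 (p. 27, eq. (7.2)) and its proof (p. 28: "if r ≥ n^d, then we are done. Otherwise …")] -/
theorem LeeRaghavendraSteurer2015_thm72_lower' {μ : X → ℝ} (hμ : IsProbWeight μ) {d r : ℕ}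
    (hn : 2 * m ≤ n) {f : (Fin m → X) → ℝ} (hf : ∀ y, 0 ≤ f y) {ε : ℝ} (hε : 0 < ε)
    {D : (Fin m → X) → ℝ} (hD : IsLocalPseudoDensity (prodWeight μ m) d D)
    (hDf : muExpect (prodWeight μ m) (fun y => D y * f y) <
      -(ε * ‖D‖ * muExpect (prodWeight μ m) f))
    (hr : HasNonnegFactorization (generalPatternMatrix n f) r) :
    (n : ℝ) ^ (d + 1) ≤ r ∨
      ε / 3 * (ε ^ 2 * n / (48 * (m : ℝ) ^ 2 * ((d + 1) * Real.log n +
        Real.log (‖f‖ / muExpect (prodWeight μ m) f) + Real.log (3 / ε)))) ^ (d + 1) < r := by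
  obtain ⟨hF₁pos, hDpos, hε1, hm, hfF⟩ := thm72_hypothesis_pos hμ hf hε hD hDf
  have hmain := LeeRaghavendraSteurer2015_thm72_lower hμ hn hf hε hD hDf hr
  set F₁ := muExpect (prodWeight μ m) f with hF₁
  have hfpos : 0 < ‖f‖ := hF₁pos.trans_le hfF
  by_cases hcase : (n : ℝ) ^ (d + 1) ≤ r
  · exact Or.inl hcase
  right
  -- `r ≥ 1`
  have hr : 0 < r := by
    rcases Nat.eq_zero_or_pos r with h0 | h
    · exfalso
      subst h0
      have h' := hmain
      simp only [Nat.cast_zero, mul_zero, zero_mul, zero_div, Real.log_zero, div_zero] at h'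
      have : (0 : ℝ) ^ (d + 1) = 0 := zero_pow (Nat.succ_ne_zero d)
      rw [this, mul_zero] at h'
      exact lt_irrefl _ h'
    · exact h
  have hrR : (0 : ℝ) < r := by exact_mod_cast hr
  have hn0 : (0 : ℝ) < n := by
    have : 0 < n := by omega
    exact_mod_cast this
  -- `log τ ≤ (d+1) log n + log(‖f‖/‖f‖₁) + log(3/ε)`
  have hτeq : 3 * (r : ℝ) * ‖f‖ / (ε * F₁) = 3 / ε * (r * (‖f‖ / F₁)) := by
    field_simp
  have hlogτ : Real.log (3 * r * ‖f‖ / (ε * F₁)) ≤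
      (d + 1) * Real.log n + Real.log (‖f‖ / F₁) + Real.log (3 / ε) := by
    rw [hτeq, Real.log_mul (by positivity) (by positivity), Real.log_mul hrR.ne' (by positivity)]
    have hlogr : Real.log r ≤ (d + 1) * Real.log n := by
      have : ((d : ℝ) + 1) * Real.log n = Real.log ((n : ℝ) ^ (d + 1)) := by
        rw [Real.log_pow]; push_cast; ring
      rw [this]
      exact Real.log_le_log hrR (not_le.mp hcase).le
    linarith
  -- `τ > 1`, so both denominators are positive
  have hτ1 : 1 < 3 * (r : ℝ) * ‖f‖ / (ε * F₁) := by
    rw [lt_div_iff₀ (by positivity)]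
    have : (1 : ℝ) ≤ r := by exact_mod_cast hr
    nlinarith
  have hlogτpos : 0 < Real.log (3 * r * ‖f‖ / (ε * F₁)) := Real.log_pos hτ1
  have hm0 : (0 : ℝ) < m := by exact_mod_cast hm
  -- monotonicity in the denominator
  have hbase : ε ^ 2 * n / (48 * (m : ℝ) ^ 2 * ((d + 1) * Real.log n +
      Real.log (‖f‖ / F₁) + Real.log (3 / ε))) ≤
      ε ^ 2 * n / (48 * (m : ℝ) ^ 2 * Real.log (3 * r * ‖f‖ / (ε * F₁))) := by
    apply div_le_div_of_nonneg_left (by positivity) (by positivity)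
    exact mul_le_mul_of_nonneg_left hlogτ (by positivity)
  have hbase0 : 0 ≤ ε ^ 2 * n / (48 * (m : ℝ) ^ 2 * ((d + 1) * Real.log n +
      Real.log (‖f‖ / F₁) + Real.log (3 / ε))) := by
    apply div_nonneg (by positivity)
    exact mul_nonneg (by positivity) (hlogτpos.le.trans hlogτ)
  calc (ε / 3 * (ε ^ 2 * n / (48 * (m : ℝ) ^ 2 * ((d + 1) * Real.log n +
        Real.log (‖f‖ / F₁) + Real.log (3 / ε)))) ^ (d + 1) : ℝ)
      ≤ ε / 3 * (ε ^ 2 * n / (48 * (m : ℝ) ^ 2 * Real.log (3 * r * ‖f‖ / (ε * F₁)))) ^ (d + 1) := by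
        gcongr
    _ < (r : ℝ) := hmain

/-! ### The approximate junta degree and the printed form of the hypothesis -/

/-- **The `ε`-approximate junta degree** `juntadeg^ε(f; μ) = 1 + max{d : ∃ a d-local pseudo-density D
w.r.t. μ with E_μ D f < −ε ‖D‖_∞ E_μ f}` (the maximum of the empty set being `−1`); typed as the
supremum over `ℕ` of the set of the numbers `d + 1`. [cite: LeeRaghavendraSteurer2015, §7.1 (p. 27, eq. (7.1))] -/
def approxJuntaDegree {ι : Type*} [Fintype ι] [DecidableEq ι] (ε : ℝ) (μ : (ι → X) → ℝ)
    (f : (ι → X) → ℝ) : ℕ :=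
  sSup {d' | ∃ d : ℕ, d' = d + 1 ∧ ∃ D : (ι → X) → ℝ, IsLocalPseudoDensity μ d D ∧
    muExpect μ (fun x => D x * f x) < -(ε * ‖D‖ * muExpect μ f)}

/-- Unfolding the approximate junta degree: if `juntadeg^ε(f; μ) > d` then some `d`-local pseudo-density
witnesses it. [cite: LeeRaghavendraSteurer2015, §7.1 (p. 27, eq. (7.1))] -/
theorem exists_pseudoDensity_of_lt_approxJuntaDegree {ι : Type*} [Fintype ι] [DecidableEq ι]
    {ε : ℝ} {μ : (ι → X) → ℝ} {f : (ι → X) → ℝ} {d : ℕ} (hd : d < approxJuntaDegree ε μ f) :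
    ∃ D : (ι → X) → ℝ, IsLocalPseudoDensity μ d D ∧
      muExpect μ (fun x => D x * f x) < -(ε * ‖D‖ * muExpect μ f) := by
  set s := {d' | ∃ d : ℕ, d' = d + 1 ∧ ∃ D : (ι → X) → ℝ, IsLocalPseudoDensity μ d D ∧
    muExpect μ (fun x => D x * f x) < -(ε * ‖D‖ * muExpect μ f)} with hs
  have hne : s.Nonempty := by
    by_contra h
    rw [Set.not_nonempty_iff_eq_empty] at h
    have : approxJuntaDegree ε μ f = 0 := by
      unfold approxJuntaDegree; rw [← hs, h, Nat.sSup_def ⟨0, fun a ha => ha.elim⟩]; simp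
    omega
  have hbdd : BddAbove s := by
    by_contra h
    have : approxJuntaDegree ε μ f = 0 := by
      unfold approxJuntaDegree; rw [← hs]; exact Nat.sSup_of_not_bddAbove h
    omega
  have hmem : approxJuntaDegree ε μ f ∈ s := by
    unfold approxJuntaDegree; rw [← hs]; exact Nat.sSup_mem hne hbdd
  obtain ⟨d₀, hd₀, D, hD, hDf⟩ := hmem
  refine ⟨D, hD.anti ?_, hDf⟩
  have : d < d₀ + 1 := by rw [← hd₀]; exact hd
  omega

/-- **Theorem 7.2 (lower bound) with the printed hypothesis `d + 1 ≤ juntadeg^ε(f; μ^m)`.**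
[cite: LeeRaghavendraSteurer2015, Thm 7.2 (p. 27)] -/
theorem LeeRaghavendraSteurer2015_thm72_lower_of_approxJuntaDegree {μ : X → ℝ} (hμ : IsProbWeight μ)
    {d r : ℕ} (hn : 2 * m ≤ n) {f : (Fin m → X) → ℝ} (hf : ∀ y, 0 ≤ f y) {ε : ℝ} (hε : 0 < ε)
    (hd : d + 1 ≤ approxJuntaDegree ε (prodWeight μ m) f)
    (hr : HasNonnegFactorization (generalPatternMatrix n f) r) :
    ∃ D : (Fin m → X) → ℝ, IsLocalPseudoDensity (prodWeight μ m) d D ∧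
      ε / 3 * (ε ^ 2 * n / (48 * (m : ℝ) ^ 2 *
        Real.log (3 * r * ‖f‖ / (ε * muExpect (prodWeight μ m) f)))) ^ (d + 1) < r := by
  obtain ⟨D, hD, hDf⟩ := exists_pseudoDensity_of_lt_approxJuntaDegree (Nat.lt_of_succ_le hd)
  exact ⟨D, hD, LeeRaghavendraSteurer2015_thm72_lower hμ hn hf hε hD hDf hr⟩

end Theorem72

end Literature.Combinatorics.Optimization
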